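import Literature.Computability.Complexity.StackProductTree
import HarnessLib

/-!
# Bluestein's evaluation on the stack machine (and the leaves of the product tree)

Literature / complexity toolkit, continuing `StackProductTree.lean`.  Two more building blocks of
Harvey's Algorithm 1 (arXiv:2010.05450, §4) on the outer register layer `HReg` / `hSt`, built only
from verified primitives (`readItemTo`, `emit`, `pour`, `prependItem`, numeric scripts `NS`,
`nToUnary`, `countLoop`/`streamLoop`, `pow2Into`) and the fast negacyclic multiplier
`negMulMachine` (`runs_negMulMachine`):

* **the leaves pass** `leafPass` / `runs_leafPass`: the value list `vs` on `A1V` becomes the leaf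
  blocks `encBlocks (vs.map linBlock)` on `BF` (the input of `runs_ptTree`), cost `leafPassCost`;
* **Bluestein's evaluation** `bluestein` / `runs_bluestein`: from the coefficient list `f` on `BLF`
  (`α` on `BLA`, `m` on `BLM`, `k` on `BLK`, the constant `2` on `BLPOW`) the machine leaves
  `encVec (bluesteinValues N α m k f)` on `BLOUT` — the values `α^E · f(α^i)`, `i < m`, by
  `bluesteinValues_spec` (`PolyProducts.lean`) — within `bluesteinCost n k |f|` steps.  The passes:
  `blFPass` (`f'_j = α^{C(j+1,2)} f_j`, one `powMod` and one `mulMod` per coefficient, padded to a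
  block of length `2^k` on `BF`: `runs_blFPass`), `blGPass` (`E = C(n₁,2) + C(m,2)` and the shifted
  chirp `g'_s = α^{E − chirpExp}` in two counted segments, padded onto `BG`: `runs_blGSeg1`,
  `runs_blGSeg2`, `runs_blGPad`, `runs_blGPass`), `blMul` (`KN := k`, `negMulMachine`:
  `runs_blMul`), `blXSkip` / `blXVals` (read the product block, skip `n₁ − 1` entries, emit
  `w_i = α^{C(i,2)} P_{n₀+i}`, pour onto `BLOUT`: `runs_blXSkip`, `runs_blXVals`), and the list
  identities `blFList_length_eq_chirpF`, `blG1_append_blG2`, `blXList_eq_bluesteinValues`.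

Every chirp factor is its own `powMod` (no inverses, no running products), which keeps the loop
invariants to "prefix emitted"; the cost is dominated by the one multiplication.

## References

* D. Harvey, *An exponent one-fifth algorithm for deterministic integer factorisation*,
  Math. Comp. 90 (2021) 2937–2950, §2.3–2.4 / arXiv:2010.05450 Lemmas 4–5 (product tree,
  Bluestein). [Harvey2021]
* L. I. Bluestein, *A linear filtering approach to the computation of discrete Fourier transform*,
  IEEE Trans. Audio Electroacoust. 18 (1970) 451–455. (Folklore material, fully proved here.)
-/

namespace Literature.Computability.Complexity

open _root_.Computability SProg

namespace Com

variable {β : Type} [DecidableEq β] (h : HReg ↪ β)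

/-! ### The leaves pass: values to linear-factor blocks -/

section Leaves

/-- One value: read `v` from `A1V`, compute `c = (N − v mod N) mod N`, build the block item
`[c, 1, 0, 0]` in `X3` and emit it onto the accumulator `L4`. [folklore] -/
def leafBody : Com (EReg ⊕ β) :=
  readItemTo (Sum.inr (h .A1V)) (Sum.inr (h .X3)) (Sum.inr (h (.g (.f (.n (.v .W)))))) (Sum.inr (h (.g (.f (.n (.v .TT)))))) ;;
  ((NS.ofList [.divMod (h .X4) (h .X5) (h .X3) (h (.g (.f (.n (.v .MD))))), .clear (h .X4), .clear (h .X3),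
      .sub (h .X4) (h (.g (.f (.n (.v .MD))))) (h .X5), .clear (h .X5), .divMod (h .X5) (h .X6) (h .X4) (h (.g (.f (.n (.v .MD))))),
      .clear (h .X5), .clear (h .X4)] : NS β).com ;;
  (prependItem (rGH h) (h .X4) (h .X3) ;; (prependItem (rGH h) (h .X4) (h .X3) ;;
  ((NS.op (.const (h .X4) [true]) : NS β).com ;; (prependItem (rGH h) (h .X4) (h .X3) ;;
  (prependItem (rGH h) (h .X6) (h .X3) ;; emit (Sum.inr (h .X3)) (Sum.inr (h .L4))))))))

/-- The leaves pass: every value of `A1V` becomes the block of `x − v` on `BF`. [folklore] -/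
def leafPass : Com (EReg ⊕ β) :=
  streamLoop (Sum.inr (h .A1V)) (Sum.inr (h .FL1)) (leafBody h) ;; pour (Sum.inr (h .L4)) (Sum.inr (h (.g .BF)))

/-- Cost of the leaves pass on `V` values (numerals of `≤ n` bits). [folklore] -/
def leafPassCost (n V : ℕ) : ℕ := V * (1000 * (n + 1) ^ 3) + 6 * V + 4 + (3 * (V * (4 * n + 22)) + 1)

/-- The coded leaf block. [folklore] -/
theorem encVec_linBlock {N v : ℕ} (hN1 : 1 < N) :
    encVec (NegFFT.linBlock (N := N) v) = dbl (encodeNat (negMod N (v % N))) ++ [false, true] ++ (dbl [true] ++ [false, true] ++ ([false, true] ++ ([false, true] ++ []))) := by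
  have e1 : encodeNat 1 = [true] := by simpa using encodeNat_two_pow 0
  have e0 : encodeNat 0 = [] := rfl
  rw [NegFFT.linBlock, Nat.mod_eq_of_lt hN1]
  simp [encVec, encList, boolPair, dbl, e1, e0]

/-- **The leaves pass.** [folklore] -/
theorem runs_leafPass {N n : ℕ} (hN1 : 1 < N) (hn : (encodeNat N).length + 1 ≤ n) (T : Regs β) (hI : DrvInv (rGH h) N T)
    (u : HSlots) (htmph : u.gw.tmph = []) (hbf : u.gw.bf = []) {vs : List ℕ} (hvs : ∀ v ∈ vs, (encodeNat v).length ≤ n)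
    (hx3 : u.x3 = []) (hx4 : u.x4 = []) (hx5 : u.x5 = []) (hx6 : u.x6 = []) (hfl1 : u.fl1 = []) :
    Runs (leafPass h) (base (hSt h T { u with a1v := encVec vs, l4 := [] }))
      (base (hSt h T { u with a1v := [], l4 := [], gw := { u.gw with bf := encBlocks (vs.map (NegFFT.linBlock (N := N))) } })) (leafPassCost n vs.length) := by
  have hhq : ∀ {i j : HReg}, i ≠ j → h i ≠ h j := fun hij => hq_ne h hij
  obtain ⟨hMD, -, -, -, -, -, hW, hTT, -, -, -, -, -, -, -, -, -, -⟩ := hI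
  have hN0 : 0 < N := by omega
  set c := (n + 1) ^ 3 with hc3
  have rdMD : ∀ u' : HSlots, hSt h T u' (h (.g (.f (.n (.v .MD))))) = encodeNat N := fun u' => by
    rw [hSt_gv h T u' (by decide) (by decide) (by decide) (by decide) (by decide) (by decide)]; exact hMD
  have rdW : ∀ u' : HSlots, hSt h T u' (h (.g (.f (.n (.v .W))))) = [] := fun u' => by
    rw [hSt_gv h T u' (by decide) (by decide) (by decide) (by decide) (by decide) (by decide)]; exact hW
  have rdTT : ∀ u' : HSlots, hSt h T u' (h (.g (.f (.n (.v .TT))))) = [] := fun u' => by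
    rw [hSt_gv h T u' (by decide) (by decide) (by decide) (by decide) (by decide) (by decide)]; exact hTT
  have rdTMPH : ∀ u' : HSlots, u'.gw.tmph = [] → hSt h T u' ((rGH h) .TMPH) = [] := fun u' hu' => by
    rw [hSt_eq_gSt, gSt_TMPH]; exact hu'
  -- the state with `l` still to do and `done` emitted
  let st : List ℕ → List ℕ → HSlots := fun done l => { u with a1v := encVec l, l4 := outRev ((done.map (NegFFT.linBlock (N := N))).map encVec) }
  have hbody : ∀ (v : ℕ) (l done : List ℕ), v ∈ vs →
      Runs (leafBody h) (base (hSt h T (st done (v :: l)))) (base (hSt h T (st (done ++ [v]) l))) (1000 * c) := by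
    intro v l done hv
    have hvn := hvs v hv
    have hr : v % N < N := Nat.mod_lt _ hN0
    have hlr : (encodeNat (v % N)).length ≤ n := (Brick.length_encodeNat_mono hr.le).trans (by omega)
    have hlq : (encodeNat (v / N)).length ≤ n := (Brick.length_encodeNat_mono (Nat.div_le_self _ _)).trans hvn
    have hls : (encodeNat (N - v % N)).length ≤ n := (Brick.length_encodeNat_mono (Nat.sub_le _ _)).trans (by omega)
    have hlc : (encodeNat (negMod N (v % N))).length ≤ n := (Brick.length_encodeNat_mono (negMod_lt hN0 _).le).trans (by omega)
    have hlq2 : (encodeNat ((N - v % N) / N)).length ≤ n := (Brick.length_encodeNat_mono (Nat.div_le_self _ _)).trans hls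
    let u0 := st done (v :: l)
    let u1 : HSlots := { u0 with a1v := encVec l, x3 := encodeNat v }
    let u2 : HSlots := { u1 with x3 := [], x6 := encodeNat (negMod N (v % N)) }
    let u3 : HSlots := { u2 with x3 := [false, true] }
    let u4 : HSlots := { u2 with x3 := [false, true] ++ [false, true] }
    let u5 : HSlots := { u4 with x4 := [true] }
    let u6 : HSlots := { u2 with x3 := dbl [true] ++ [false, true] ++ ([false, true] ++ [false, true]) }
    let u7 : HSlots := { u2 with x6 := [], x3 := dbl (encodeNat (negMod N (v % N))) ++ [false, true] ++ (dbl [true] ++ [false, true] ++ ([false, true] ++ [false, true])) }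
    let u8 : HSlots := st (done ++ [v]) l
    have h1 : Runs (readItemTo (Sum.inr (h .A1V)) (Sum.inr (h .X3)) (Sum.inr (h (.g (.f (.n (.v .W)))))) (Sum.inr (h (.g (.f (.n (.v .TT)))))))
        (base (hSt h T u0)) (base (hSt h T u1)) (11 * n + 9) := by
      refine (runs_readItemTo (by simp [hhq]) (by simp [hhq]) (by simp [hhq]) (by simp [hhq]) (by simp [hhq]) (encodeNat v) (encVec l)
        (base (hSt h T u0)) (by simp [u0, st, encVec_cons]) (by simp [rdW]) (by simp [rdTT])).of_eq ?_ (by omega)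
      simp [u0, u1, st, hx3]
    have h2 : Runs (NS.ofList [.divMod (h .X4) (h .X5) (h .X3) (h (.g (.f (.n (.v .MD))))), .clear (h .X4), .clear (h .X3),
        .sub (h .X4) (h (.g (.f (.n (.v .MD))))) (h .X5), .clear (h .X5), .divMod (h .X5) (h .X6) (h .X4) (h (.g (.f (.n (.v .MD))))),
        .clear (h .X5), .clear (h .X4)] : NS β).com (base (hSt h T u1)) (base (hSt h T u2)) (786 * c) := by
      refine NS.runs_of_eq (N := n) _ _ ?_ ?_ (by simp [hc3])
      · simp only [NS.ofList, NS.ok, NOp.ok, NS.eval, NOp.eval, hSt_X3, hSt_X4, hSt_X5, hSt_X6, update_hSt_X4, update_hSt_X5, update_hSt_X3, update_hSt_X6,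
          rdMD, u1, u0, st, hx4, hx5, hx6, bitsToNat_encodeNat, ne_eq, EmbeddingLike.apply_eq_iff_eq, List.length_nil]
        exact ⟨⟨by decide, by decide, by decide, by decide, by decide, hvn, by omega, by omega, by omega, hN0⟩, hlq, hvn, ⟨by omega, hlr, by omega, hr.le⟩, hlr,
          ⟨by decide, by decide, by decide, by decide, by decide, hls, by omega, by omega, by omega, hN0⟩, hlq2, hls, trivial⟩
      · simp [u1, u2, u0, st, hx4, hx5, hx6, rdMD, negMod]
    have hP : ∀ (ua : HSlots) (s : List Bool), ua.gw.tmph = [] → ua.x4 = s →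
        Runs (prependItem (rGH h) (h .X4) (h .X3)) (base (hSt h T ua)) (base (hSt h T { ua with x4 := [], x3 := dbl s ++ [false, true] ++ ua.x3 })) (10 * s.length + 10) := by
      intro ua s sht hs
      refine (runs_prependItem (rGH h) (rGH_ne h .X4 (fun _ e => HReg.noConfusion e) .TMPH).symm (rGH_ne h .X3 (fun _ e => HReg.noConfusion e) .TMPH).symm (hhq (by decide))
        (hSt h T ua) (rdTMPH ua sht)).of_eq ?_ (by simp [hs])
      simp [hs]
    have h3 := hP u2 [] (by simp [u2, u1, u0, st, htmph]) (by simp [u2, u1, u0, st, hx4])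
    have h4 := hP { u2 with x4 := [], x3 := dbl [] ++ [false, true] ++ u2.x3 } [] (by simp [u2, u1, u0, st, htmph]) rfl
    have h5 : Runs (NS.op (.const (h .X4) [true]) : NS β).com (base (hSt h T { u2 with x4 := [], x3 := dbl ([] : List Bool) ++ [false, true] ++ (dbl ([] : List Bool) ++ [false, true] ++ u2.x3) }))
        (base (hSt h T { u2 with x4 := [true], x3 := dbl ([] : List Bool) ++ [false, true] ++ (dbl ([] : List Bool) ++ [false, true] ++ u2.x3) })) (4 * c) := by
      refine NS.runs_of_eq (N := n) _ _ ?_ ?_ (by simp [hc3])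
      · simp [NS.ok, NOp.ok]; omega
      · simp
    have h6 := hP { u2 with x4 := [true], x3 := dbl ([] : List Bool) ++ [false, true] ++ (dbl ([] : List Bool) ++ [false, true] ++ u2.x3) } [true]
      (by simp [u2, u1, u0, st, htmph]) rfl
    have h7 : ∀ (ua : HSlots), ua.gw.tmph = [] →
        Runs (prependItem (rGH h) (h .X6) (h .X3)) (base (hSt h T ua)) (base (hSt h T { ua with x6 := [], x3 := dbl ua.x6 ++ [false, true] ++ ua.x3 })) (10 * ua.x6.length + 10) := by
      intro ua sht
      refine (runs_prependItem (rGH h) (rGH_ne h .X6 (fun _ e => HReg.noConfusion e) .TMPH).symm (rGH_ne h .X3 (fun _ e => HReg.noConfusion e) .TMPH).symm (hhq (by decide))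
        (hSt h T ua) (rdTMPH ua sht)).of_eq ?_ (by simp)
      simp
    have h7' := h7 { u2 with x4 := [], x3 := dbl [true] ++ [false, true] ++ (dbl ([] : List Bool) ++ [false, true] ++ (dbl ([] : List Bool) ++ [false, true] ++ u2.x3)) }
      (by simp [u2, u1, u0, st, htmph])
    have h8 : ∀ (ua : HSlots), Runs (emit (Sum.inr (h .X3)) (Sum.inr (h .L4))) (base (hSt h T ua))
        (base (hSt h T { ua with x3 := [], l4 := true :: false :: ((ua.x3.flatMap fun b => [b, b]).reverse ++ ua.l4) })) (4 * ua.x3.length + 3) := by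
      intro ua
      refine (runs_emit (h := (Sum.inr (h .X3) : EReg ⊕ β)) (o := Sum.inr (h .L4)) (by simp [hhq]) (base (hSt h T ua))).of_eq ?_ (by simp)
      simp
    have h8' := h8 { u2 with x4 := [], x6 := [], x3 := dbl u2.x6 ++ [false, true] ++ (dbl [true] ++ [false, true] ++ (dbl ([] : List Bool) ++ [false, true] ++ (dbl ([] : List Bool) ++ [false, true] ++ u2.x3))) }
    have hfin : { ({ u2 with x4 := [], x6 := [], x3 := dbl u2.x6 ++ [false, true] ++ (dbl [true] ++ [false, true] ++ (dbl ([] : List Bool) ++ [false, true] ++ (dbl ([] : List Bool) ++ [false, true] ++ u2.x3))) } : HSlots) with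
        x3 := [], l4 := true :: false :: (((dbl u2.x6 ++ [false, true] ++ (dbl [true] ++ [false, true] ++ (dbl ([] : List Bool) ++ [false, true] ++ (dbl ([] : List Bool) ++ [false, true] ++ u2.x3)))).flatMap fun b => [b, b]).reverse ++ u2.l4) }
        = st (done ++ [v]) l := by
      simp [u2, u1, u0, st, hx3, hx4, hx5, hx6, List.map_append, outRev_append, encVec_linBlock hN1, dbl]
    rw [hfin] at h8'
    refine (h1.seq (h2.seq (h3.seq (h4.seq (h5.seq (h6.seq (h7'.seq h8'))))))).mono ?_
    have e6 : u2.x6 = encodeNat (negMod N (v % N)) := rfl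
    have e3 : u2.x3 = [] := rfl
    simp only [e6, e3, List.length_append, List.length_cons, List.length_nil, length_dbl]
    have hc1 : n + 1 ≤ c := by
      rw [hc3]; calc n + 1 = (n + 1) ^ 1 := (pow_one _).symm
        _ ≤ (n + 1) ^ 3 := Nat.pow_le_pow_right (by omega) (by omega)
    omega
  -- the loop
  have hloop := runs_streamLoop (L := (Sum.inr (h .A1V) : EReg ⊕ β)) (w := Sum.inr (h .FL1)) (by simp [hhq]) (body := leafBody h)
    encVec (by simp [encVec]) (fun a l => by simp [encVec_cons])
    (fun l R => ∃ done, done ++ l = vs ∧ R = base (hSt h T (st done l)))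
    (fun _ => 1000 * c)
    (by
      rintro a l R ⟨done, hdl, rfl⟩ - -
      have ha : a ∈ vs := by rw [← hdl]; simp
      exact ⟨_, hbody a l done ha, by simp [st], by simp [st, hfl1], done ++ [a], by simpa using hdl, rfl⟩)
    vs (base (hSt h T { u with a1v := encVec vs, l4 := [] })) ⟨[], by simp, by simp [st]⟩ (by simp) (by simp [hfl1])
  obtain ⟨R', hL, -, -, done, hdone, rfl⟩ := hloop
  simp only [List.append_nil] at hdone
  subst hdone
  -- the final pour
  have hpour := runs_opour (a := h .L4) (b := h (.g .BF)) (hhq (by decide)) (hSt h T (st done []))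
  have hlen : ∀ E : List (List Bool), (∀ a ∈ E, a.length ≤ 2 * n + 10) → (outRev E).length ≤ E.length * (4 * n + 22) := by
    intro E hE
    rw [outRev, List.length_reverse]
    induction E with
    | nil => simp
    | cons a E ih =>
      have ha := hE a (by simp)
      have := ih (fun b hb => hE b (by simp [hb]))
      simp only [List.flatMap_cons, List.length_append, List.length_flatMap, List.length_cons, List.length_nil, List.map_const',
        List.sum_replicate, smul_eq_mul] at this ⊢
      nlinarith
  have hE : ∀ a ∈ (done.map (NegFFT.linBlock (N := N))).map encVec, a.length ≤ 2 * n + 10 := by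
    intro a ha
    simp only [List.map_map, List.mem_map, Function.comp] at ha
    obtain ⟨v, hv, rfl⟩ := ha
    have hlc : (encodeNat (negMod N (v % N))).length ≤ n := (Brick.length_encodeNat_mono (negMod_lt hN0 _).le).trans (by omega)
    rw [encVec_linBlock hN1]; simp only [List.length_append, length_dbl, List.length_cons, List.length_nil]; omega
  have hl := hlen _ hE
  simp only [List.length_map] at hl
  refine (hL.seq (hpour.of_eq ?_ le_rfl)).mono ?_
  · simp [st, reverse_outRev, encBlocks, hbf]
  · simp only [leafPassCost, List.map_const', List.sum_replicate, smul_eq_mul, hSt_L4, st]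
    nlinarith [hl]

end Leaves

/-! ### Bluestein's evaluation on the machine

The values `bluesteinValues N α m k f` (`PolyProducts`): the chirp-weighted coefficients
`f'` and the shifted chirp `g'` are produced element by element with `powMod`/`mulMod`
scripts, padded to blocks of length `2^k`, multiplied by the breadth-first negacyclic
multiplier, and the values `α^{C(i,2)} · (f'g')_{i+n₀}` are read off the product. -/

section Bluestein

/-- `f'_j = α^{C(j+1,2)} f_j`: read `f_j`, `C(j+1,2) = (j+1)j/2`, one `powMod`, one `mulMod`, emit;
the counter `BLC1` holds `j`. [folklore] -/
def blFBody : Com (EReg ⊕ β) :=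
  readItemTo (Sum.inr (h .BLF)) (Sum.inr (h .X3)) (Sum.inr (h (.g (.f (.n (.v .W)))))) (Sum.inr (h (.g (.f (.n (.v .TT)))))) ;;
  ((NS.ofList [.succ (h .X4) (h .BLC1), .mul (h .X5) (h .X4) (h .BLC1), .divMod (h .X6) (h .X2) (h .X5) (h .BLPOW), .clear (h .X2), .clear (h .X5),
      .powMod (h .X5) (h .BLA) (h .X6) (h (.g (.f (.n (.v .MD))))), .clear (h .X6), .mulMod (h .X5) (h .X3) (h (.g (.f (.n (.v .MD))))),
      .clear (h .X3), .clear (h .BLC1), .move (h .X4) (h .BLC1)] : NS β).com ;;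
  emit (Sum.inr (h .X5)) (Sum.inr (h .L4)))

/-- Appending `Z` zero items to the emitted (reversed) accumulator `L4`, `Z` in unary on `U1`. [folklore] -/
def blZeros : Com (EReg ⊕ β) :=
  countLoop (Sum.inr (h .U1)) ((NS.ofList [.push (h .L4) false, .push (h .L4) true] : NS β).com)

/-- Wrapping the accumulator `L4` as one block item poured onto the block register `dst`. [folklore] -/
def blWrap (dst : HReg) : Com (EReg ⊕ β) :=
  pour (Sum.inr (h .L4)) (Sum.inr (h .X3)) ;; (emit (Sum.inr (h .X3)) (Sum.inr (h .L4)) ;; pour (Sum.inr (h .L4)) (Sum.inr (h dst)))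

/-- The `f'` pass: all of `f`, then `2^k − (n₀+1)` zeros, wrapped onto `BF`. [folklore] -/
def blFPass : Com (EReg ⊕ β) :=
  streamLoop (Sum.inr (h .BLF)) (Sum.inr (h .FL1)) (blFBody h) ;;
  (pow2Into (rGH h) (h .X4) (h .BLK) ;;
  (((NS.ofList [.sub (h .X5) (h .X4) (h .BLC1), .clear (h .X4)] : NS β).com) ;;
  (nToUnary (h .U1) (h .X5) ;;
  (((NS.op (.clear (h .X5))) : NS β).com ;;
  (blZeros h ;; blWrap h (.g .BF))))))

/-- Appending zeros to the reversed accumulator. [folklore] -/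
theorem runs_blZeros (T : Regs β) (ua : HSlots) (E : List (List Bool)) (Z : ℕ) (hl4 : ua.l4 = outRev E) (hu1 : ua.u1 = List.replicate Z true) :
    Runs (blZeros h) (base (hSt h T ua)) (base (hSt h T { ua with u1 := [], l4 := outRev (E ++ List.replicate Z []) })) (Z * (2 + 2) + 1) := by
  let zst : ℕ → HSlots := fun i => { ua with u1 := List.replicate i true, l4 := outRev (E ++ List.replicate (Z - i) []) }
  have hl := runs_countLoop (U := (Sum.inr (h .U1) : EReg ⊕ β)) (body := ((NS.ofList [.push (h .L4) false, .push (h .L4) true] : NS β).com))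
    (fun i R => i ≤ Z ∧ R = base (hSt h T (zst i))) 2
    (by
      rintro i R ⟨hi, rfl⟩ -
      refine ⟨base (hSt h T (zst i)), ?_, by simp [zst], by omega, rfl⟩
      have : Function.update (base (hSt h T (zst (i + 1)))) (Sum.inr (h .U1)) (List.replicate i true) = base (hSt h T { zst i with l4 := outRev (E ++ List.replicate (Z - (i + 1)) []) }) := by
        simp [zst]
      rw [this]
      refine NS.runs_of_eq (N := 0) _ _ (by simp [NS.ofList]) ?_ (by simp)
      have hz : Z - i = Z - (i + 1) + 1 := by omega
      simp [NS.ofList, zst, hz, List.replicate_succ', outRev_append, ← List.append_assoc])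
    Z (base (hSt h T ua)) ⟨le_rfl, by simp [zst, ← hu1, ← hl4]⟩ (by simp [hu1])
  obtain ⟨R', hR, -, -, rfl⟩ := hl
  exact hR.of_eq (by simp [zst]) le_rfl

/-- Wrapping the accumulator as one block item onto `dst`. [folklore] -/
theorem runs_blWrap {N n : ℕ} (hn : (encodeNat N).length + 1 ≤ n) {dst : HReg} (hd3 : dst ≠ .X3) (hd4 : dst ≠ .L4) (T'' : Regs β)
    {B : List ℕ} (hBN : ∀ x ∈ B, x < N) (hl4 : T'' (h .L4) = outRev (B.map encodeNat)) (hx3 : T'' (h .X3) = []) :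
    Runs (blWrap h dst) (base T'')
      (base (Function.update (Function.update T'' (h .L4) []) (h dst) (encBlocks [B] ++ T'' (h dst)))) (13 * (B.length * (2 * n)) + 11) := by
  have hhq : ∀ {i j : HReg}, i ≠ j → h i ≠ h j := fun hij => hq_ne h hij
  have hlx : (encVec B).length ≤ B.length * (2 * n) := length_encVec_le_of_lt hBN hn
  have hrev : (outRev (B.map encodeNat)).reverse = encVec B := by rw [reverse_outRev]; rfl
  have hlo : (outRev (B.map encodeNat)).length = (encVec B).length := by rw [← hrev, List.length_reverse]
  have h1 := runs_opour (a := h .L4) (b := h .X3) (hhq (by decide)) T''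
  rw [hl4, hrev, hx3, List.append_nil] at h1
  have h2 := runs_emit (h := (Sum.inr (h .X3) : EReg ⊕ β)) (o := Sum.inr (h .L4)) (by simp [hhq])
    (base (Function.update (Function.update T'' (h .L4) []) (h .X3) (encVec B)))
  have h3 := runs_opour (a := h .L4) (b := h dst) (hhq hd4.symm)
    (Function.update (Function.update (Function.update (Function.update T'' (h .L4) []) (h .X3) (encVec B)) (h .X3) []) (h .L4)
      (true :: false :: (((encVec B).flatMap fun b => [b, b]).reverse ++ [])))
  refine ((h1.seq ((h2.of_eq (by simp [hhq]) le_rfl).seq (h3.of_eq ?_ le_rfl))).of_eq rfl ?_)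
  · congr 1
    funext r
    by_cases h₁ : r = h dst
    · subst h₁; simp [hhq, hd3, hd4, encBlocks, encList, boolPair, encVec]
    · by_cases h₂ : r = h .L4
      · subst h₂; simp [Ne.symm (hhq hd4)]
      · by_cases h₃ : r = h .X3
        · subst h₃; simp [hhq, h₁, hx3]
        · simp [h₁, h₂, h₃]
  · have hA : (outRev (List.map encodeNat B)).length ≤ B.length * (2 * n) := hlo ▸ hlx
    have hC : (true :: false :: (((encVec B).flatMap fun b => [b, b]).reverse ++ [])).length = 2 * (encVec B).length + 2 := by
      simp only [List.length_cons, List.length_append, List.length_reverse, List.length_flatMap, List.length_nil, List.map_const', List.sum_replicate,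
        smul_eq_mul]; ring
    simp only [nst_inr, Function.update_self, hC]
    omega

/-- The machine's `f'` entries. [folklore] -/
def blFList (N α : ℕ) (f : List ℕ) (d : ℕ) : List ℕ := (List.range d).map fun j => α ^ ((j + 1) * j / 2) % N * f.getD j 0 % N

/-- `blFList_succ`. [folklore] -/
theorem blFList_succ (N α : ℕ) (f : List ℕ) (d : ℕ) :
    blFList N α f (d + 1) = blFList N α f d ++ [α ^ ((d + 1) * d / 2) % N * f.getD d 0 % N] := by
  simp [blFList, List.range_succ]

/-- `blFList_length_eq_chirpF`. [folklore] -/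
theorem blFList_length_eq_chirpF (N α : ℕ) (f : List ℕ) : blFList N α f f.length = NegFFT.chirpF N α f := by
  simp only [blFList, NegFFT.chirpF]
  refine List.map_congr_left fun j _ => ?_
  rw [Nat.choose_two_right, Nat.add_sub_cancel, Nat.mod_mul_mod]

/-- Cost of the `f'` pass. [folklore] -/
def blFPassCost (n k V : ℕ) : ℕ :=
  V * (3700 * (n + 1) ^ 3) + 6 * V + 4 + (n * (16 * k + 21) + 3 * k + 7) + 77 * (n + 1) ^ 3 + ((k + 1) * (16 * 2 ^ k + 21) + 5) +
    (2 ^ k * (2 * (n + 1) ^ 3 + 2) + 1) + 30 * (2 ^ k * (n + 1))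

/-- **The `f'` pass.** [folklore] -/
theorem runs_blFPass {N n k α : ℕ} (hN1 : 1 < N) (hn : (encodeNat N).length + 1 ≤ n) (hkn : 2 * k + 4 ≤ n) (T : Regs β) (hI : DrvInv (rGH h) N T)
    (u : HSlots) (hbf : u.gw.bf = []) {f : List ℕ} (hfN : ∀ v ∈ f, v < N) (hfk : f.length ≤ 2 ^ (k - 1)) (hαN : α < N)
    (hbla : u.bla = encodeNat α) (hblk : u.blk = encodeNat k) (hblpow : u.blpow = encodeNat 2) (hblc1 : u.blc1 = [])
    (hx2 : u.x2 = []) (hx3 : u.x3 = []) (hx4 : u.x4 = []) (hx5 : u.x5 = []) (hx6 : u.x6 = []) (hfl1 : u.fl1 = []) (hu1 : u.u1 = []) (hl4 : u.l4 = []) :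
    Runs (blFPass h) (base (hSt h T { u with blf := encVec f }))
      (base (hSt h T { u with blf := [], blc1 := encodeNat f.length, gw := { u.gw with bf := encBlocks [List.rightpad (2 ^ k) 0 (NegFFT.chirpF N α f)] } }))
      (blFPassCost n k f.length) := by
  have hhq : ∀ {i j : HReg}, i ≠ j → h i ≠ h j := fun hij => hq_ne h hij
  obtain ⟨hMD, -, -, -, -, -, hW, hTT, -, -, hU, -, -, -, -, -, -, -⟩ := hI
  have hN0 : 0 < N := by omega
  set c := (n + 1) ^ 3 with hc3
  have hc1 : n + 1 ≤ c := by
    rw [hc3]; calc n + 1 = (n + 1) ^ 1 := (pow_one _).symm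
      _ ≤ (n + 1) ^ 3 := Nat.pow_le_pow_right (by omega) (by omega)
  have rdMD : ∀ u' : HSlots, hSt h T u' (h (.g (.f (.n (.v .MD))))) = encodeNat N := fun u' => by
    rw [hSt_gv h T u' (by decide) (by decide) (by decide) (by decide) (by decide) (by decide)]; exact hMD
  have rdW : ∀ u' : HSlots, hSt h T u' (h (.g (.f (.n (.v .W))))) = [] := fun u' => by
    rw [hSt_gv h T u' (by decide) (by decide) (by decide) (by decide) (by decide) (by decide)]; exact hW
  have rdTT : ∀ u' : HSlots, hSt h T u' (h (.g (.f (.n (.v .TT))))) = [] := fun u' => by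
    rw [hSt_gv h T u' (by decide) (by decide) (by decide) (by decide) (by decide) (by decide)]; exact hTT
  have rdU : ∀ u' : HSlots, hSt h T u' (h (.g (.f (.n (.v .U))))) = [] := fun u' => by
    rw [hSt_gv h T u' (by decide) (by decide) (by decide) (by decide) (by decide) (by decide)]; exact hU
  have hlN : (encodeNat N).length ≤ n := by omega
  have hlα : (encodeNat α).length ≤ n := (Brick.length_encodeNat_mono hαN.le).trans hlN
  have e2 : encodeNat 2 = [false, true] := by simpa using encodeNat_two_pow 1
  have hl2' : (encodeNat 2).length ≤ n := by rw [e2]; simp only [List.length_cons, List.length_nil]; omega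
  have hk1 : 2 ^ (k - 1) ≤ 2 ^ k := Nat.pow_le_pow_right (by omega) (by omega)
  have h2kk : 2 ^ k ≤ 2 ^ (2 * k) := Nat.pow_le_pow_right (by omega) (by omega)
  have hl2k : ∀ x, x ≤ 2 ^ (2 * k) → (encodeNat x).length ≤ n := fun x hx =>
    (Brick.length_encodeNat_mono hx).trans (by rw [encodeNat_two_pow]; simp; omega)
  -- the states of the stream
  let st : ℕ → List ℕ → HSlots := fun d l => { u with blf := encVec l, blc1 := encodeNat d, l4 := outRev ((blFList N α f d).map encodeNat) }
  have hbody : ∀ (d : ℕ) (v : ℕ) (l : List ℕ), v ∈ f → d + 1 ≤ f.length → f.getD d 0 = v →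
      Runs (blFBody h) (base (hSt h T (st d (v :: l)))) (base (hSt h T (st (d + 1) l))) (3700 * c) := by
    intro d v l hv hd hdv
    have hvN := hfN v hv
    have hlv : (encodeNat v).length ≤ n := (Brick.length_encodeNat_mono hvN.le).trans hlN
    have hd1 : d + 1 ≤ 2 ^ k := by omega
    have hdd : (d + 1) * d ≤ 2 ^ (2 * k) := by
      calc (d + 1) * d ≤ 2 ^ k * 2 ^ k := Nat.mul_le_mul hd1 (by omega)
        _ = 2 ^ (2 * k) := by rw [← pow_add, two_mul]
    have hld : (encodeNat d).length ≤ n := hl2k d (by omega)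
    have hld1 : (encodeNat (d + 1)).length ≤ n := hl2k (d + 1) (by omega)
    have hldd : (encodeNat ((d + 1) * d)).length ≤ n := hl2k _ hdd
    have hlC : (encodeNat ((d + 1) * d / 2)).length ≤ n := hl2k _ ((Nat.div_le_self _ _).trans hdd)
    have hlCr : (encodeNat ((d + 1) * d % 2)).length ≤ n :=
      hl2k _ (by have := Nat.mod_lt ((d + 1) * d) (show 0 < 2 by omega); have := Nat.one_le_two_pow (n := 2 * k); omega)
    have hlp : (encodeNat (α ^ ((d + 1) * d / 2) % N)).length ≤ n := (Brick.length_encodeNat_mono (Nat.mod_lt _ hN0).le).trans hlN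
    have hlw : (encodeNat (α ^ ((d + 1) * d / 2) % N * v % N)).length ≤ n := (Brick.length_encodeNat_mono (Nat.mod_lt _ hN0).le).trans hlN
    let u0 := st d (v :: l)
    let u1 : HSlots := { u0 with blf := encVec l, x3 := encodeNat v }
    let u2 : HSlots := { u1 with x3 := [], blc1 := encodeNat (d + 1), x5 := encodeNat (α ^ ((d + 1) * d / 2) % N * v % N) }
    have h1 : Runs (readItemTo (Sum.inr (h .BLF)) (Sum.inr (h .X3)) (Sum.inr (h (.g (.f (.n (.v .W)))))) (Sum.inr (h (.g (.f (.n (.v .TT)))))))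
        (base (hSt h T u0)) (base (hSt h T u1)) (11 * n + 9) := by
      refine (runs_readItemTo (by simp [hhq]) (by simp [hhq]) (by simp [hhq]) (by simp [hhq]) (by simp [hhq]) (encodeNat v) (encVec l)
        (base (hSt h T u0)) (by simp [u0, st, encVec_cons]) (by simp [rdW]) (by simp [rdTT])).of_eq ?_ (by omega)
      simp [u0, u1, st, hx3]
    have h2 : Runs (NS.ofList [.succ (h .X4) (h .BLC1), .mul (h .X5) (h .X4) (h .BLC1), .divMod (h .X6) (h .X2) (h .X5) (h .BLPOW), .clear (h .X2), .clear (h .X5),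
        .powMod (h .X5) (h .BLA) (h .X6) (h (.g (.f (.n (.v .MD))))), .clear (h .X6), .mulMod (h .X5) (h .X3) (h (.g (.f (.n (.v .MD))))),
        .clear (h .X3), .clear (h .BLC1), .move (h .X4) (h .BLC1)] : NS β).com (base (hSt h T u1)) (base (hSt h T u2)) (3555 * c) := by
      refine NS.runs_of_eq (N := n) _ _ ?_ ?_ (by simp [hc3])
      · simp only [NS.ofList, NS.ok, NOp.ok, NS.eval, NOp.eval, hSt_X2, hSt_X3, hSt_X4, hSt_X5, hSt_X6, hSt_BLC1, hSt_BLPOW, hSt_BLA,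
          update_hSt_X2, update_hSt_X3, update_hSt_X4, update_hSt_X5, update_hSt_X6, update_hSt_BLC1,
          rdMD, u1, u0, st, hx2, hx4, hx5, hx6, hbla, hblpow, bitsToNat_encodeNat, ne_eq, EmbeddingLike.apply_eq_iff_eq, List.length_nil]
        exact ⟨⟨hld, by omega⟩, ⟨hld1, hld, by omega⟩, ⟨by decide, by decide, by decide, by decide, by decide, hldd, hl2', by omega, by omega, by omega⟩, hlCr, hldd,
          ⟨by decide, by decide, by decide, by omega, hlα, hlC, hlN, hN1⟩, hlC, ⟨by decide, by decide, hlp, hlv, hlN, hN0⟩, hlv, hld, ⟨by decide, hld1⟩, trivial⟩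
      · simp [u1, u2, u0, st, hx2, hx4, hx5, hx6, hbla, hblpow, rdMD]
    have h3 : Runs (emit (Sum.inr (h .X5)) (Sum.inr (h .L4))) (base (hSt h T u2)) (base (hSt h T (st (d + 1) l))) (4 * n + 3) := by
      refine (runs_emit (h := (Sum.inr (h .X5) : EReg ⊕ β)) (o := Sum.inr (h .L4)) (by simp [hhq]) (base (hSt h T u2))).of_eq ?_ ?_
      · have hdv' : f[d]?.getD 0 = v := by rw [← List.getD_eq_getElem?_getD]; exact hdv
        simp [u2, u1, u0, st, hx3, hx5, blFList_succ, hdv', List.map_append, outRev_append]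
      · simp only [nst_inr, hSt_X5, u2]; omega
    exact (h1.seq (h2.seq h3)).mono (by omega)
  -- facts about dropping
  have hdropfacts : ∀ (g : List ℕ) (d a : ℕ) (l : List ℕ), g.drop d = a :: l → g.drop (d + 1) = l ∧ g.getD d 0 = a := by
    intro g
    induction g with
    | nil => intro d a l hh; simp at hh
    | cons x g ih =>
      intro d a l hh
      cases d with
      | zero => simp at hh; obtain ⟨rfl, rfl⟩ := hh; simp
      | succ d => simp only [List.drop_succ_cons] at hh; simpa using ih d a l hh
  -- the stream loop
  have hloop := runs_streamLoop (L := (Sum.inr (h .BLF) : EReg ⊕ β)) (w := Sum.inr (h .FL1)) (by simp [hhq]) (body := blFBody h)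
    encVec (by simp [encVec]) (fun a l => by simp [encVec_cons])
    (fun l R => ∃ d, d + l.length = f.length ∧ f.drop d = l ∧ R = base (hSt h T (st d l)))
    (fun _ => 3700 * c)
    (by
      rintro a l R ⟨d, hdl, hdrop, rfl⟩ - -
      have ha : a ∈ f := List.mem_of_mem_drop (l := f) (i := d) (by rw [hdrop]; simp)
      obtain ⟨hdrop', hdv⟩ := hdropfacts f d a l hdrop
      simp only [List.length_cons] at hdl
      exact ⟨_, hbody d a l ha (by omega) hdv, by simp [st], by simp [st, hfl1], d + 1, by omega, hdrop', rfl⟩)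
    f (base (hSt h T { u with blf := encVec f })) ⟨0, by simp, rfl, by simp [st, blFList, hblc1, hl4, show encodeNat 0 = [] from rfl]⟩ (by simp) (by simp [hfl1])
  obtain ⟨R', hL, -, -, d, hdl, -, rfl⟩ := hloop
  simp only [List.length_nil, Nat.add_zero] at hdl
  subst hdl
  set Lf := blFList N α f f.length with hLf0
  set Z := 2 ^ k - f.length with hZ0
  have hfk' : f.length ≤ 2 ^ k := hfk.trans hk1
  have hLfN : ∀ x ∈ Lf, x < N := fun x hx => by
    simp only [hLf0, blFList, List.mem_map, List.mem_range] at hx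
    obtain ⟨j, -, rfl⟩ := hx; exact Nat.mod_lt _ hN0
  have hLfl : Lf.length = f.length := by simp [hLf0, blFList]
  have hpad : Lf ++ List.replicate Z 0 = List.rightpad (2 ^ k) 0 (NegFFT.chirpF N α f) := by
    rw [List.rightpad, hLf0, blFList_length_eq_chirpF]; simp [NegFFT.chirpF, hZ0]
  have hpadN : ∀ x ∈ Lf ++ List.replicate Z 0, x < N := fun x hx => by
    rcases List.mem_append.1 hx with hx | hx
    · exact hLfN x hx
    · rw [List.eq_of_mem_replicate hx]; exact hN0
  have hpadl : (Lf ++ List.replicate Z 0).length = 2 ^ k := by simp [hLfl, hZ0]; omega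
  have hlx : (encVec (Lf ++ List.replicate Z 0)).length ≤ 2 ^ k * (2 * n) := by
    have := length_encVec_le_of_lt hpadN hn; rwa [hpadl] at this
  have hlk : (encodeNat k).length ≤ n := (length_encodeNat_le_succ (le_two_pow_self k)).trans (by omega)
  have hl2k1 : (encodeNat (2 ^ k)).length ≤ n := by rw [encodeNat_two_pow]; simp; omega
  have hlfl : (encodeNat f.length).length ≤ n := hl2k _ (by omega)
  have hlZ : (encodeNat Z).length ≤ k + 1 := (Brick.length_encodeNat_mono (Nat.sub_le _ _)).trans (by rw [encodeNat_two_pow]; simp)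
  let uA := st f.length []
  let uB : HSlots := { uA with x4 := encodeNat (2 ^ k) }
  let uC : HSlots := { uB with x4 := [], x5 := encodeNat Z }
  let uD : HSlots := { uC with u1 := List.replicate Z true }
  let uE : HSlots := { uD with x5 := [] }
  let zst : ℕ → HSlots := fun i => { uE with u1 := List.replicate i true, l4 := outRev ((Lf ++ List.replicate (Z - i) 0).map encodeNat) }
  let uF : HSlots := { zst 0 with l4 := [], x3 := encVec (Lf ++ List.replicate Z 0) }
  let uG : HSlots := { uF with x3 := [], l4 := true :: false :: ((encVec (Lf ++ List.replicate Z 0)).flatMap fun b => [b, b]).reverse }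
  have hB : Runs (pow2Into (rGH h) (h .X4) (h .BLK)) (base (hSt h T uA)) (base (hSt h T uB)) (n * (16 * k + 21) + 3 * k + 7) := by
    refine (runs_pow2Into (rGH h) (dst := h .X4) (src := h .BLK) (rGH_ne h .X4 (fun _ e => HReg.noConfusion e) _).symm (hhq (by decide)) hlk (hSt h T uA)
      (by simp [uA, st, hblk]) (by simp [uA, st, hx4]) (rdU uA)).of_eq ?_ le_rfl
    simp [uA, uB]
  have hC : Runs (NS.ofList [.sub (h .X5) (h .X4) (h .BLC1), .clear (h .X4)] : NS β).com (base (hSt h T uB)) (base (hSt h T uC)) (74 * c) := by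
    refine NS.runs_of_eq (N := n) _ _ ?_ ?_ (by simp [hc3])
    · simp only [NS.ofList, NS.ok, NOp.ok, NS.eval, NOp.eval, hSt_X4, hSt_X5, hSt_BLC1, update_hSt_X5, uB, uA, st, hx5, bitsToNat_encodeNat, List.length_nil]
      exact ⟨⟨hl2k1, hlfl, by omega, hfk'⟩, hl2k1, trivial⟩
    · simp [uB, uC, uA, st, hx5, hZ0]
  have hD : Runs (nToUnary (h .U1) (h .X5)) (base (hSt h T uC)) (base (hSt h T uD)) ((k + 1) * (16 * 2 ^ k + 21) + 5) := by
    refine (runs_nToUnary (h .U1) (h .X5) (hSt h T uC) (by simp [uC, uB, uA, st, hu1])).of_eq ?_ ?_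
    · simp [uC, uD]
    · simp only [hSt_X5, uC, bitsToNat_encodeNat]
      have hZk : Z ≤ 2 ^ k := Nat.sub_le _ _
      exact Nat.add_le_add_right (Nat.mul_le_mul hlZ (by omega)) _
  have hE : Runs (NS.op (.clear (h .X5)) : NS β).com (base (hSt h T uD)) (base (hSt h T uE)) (3 * c) := by
    refine NS.runs_of_eq (N := n) _ _ ?_ ?_ (by simp [hc3])
    · simp only [NS.ok, NOp.ok, hSt_X5, uD, uC]
      exact (hlZ.trans (by omega))
    · simp [uD, uE]
  have hZr : Runs (blZeros h) (base (hSt h T uE)) (base (hSt h T { uE with u1 := [], l4 := outRev (Lf.map encodeNat ++ List.replicate Z []) })) (Z * (2 + 2) + 1) :=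
    runs_blZeros h T uE (Lf.map encodeNat) Z (by simp [uE, uD, uC, uB, uA, st, hLf0]) (by simp [uE, uD])
  have hmapE : (Lf ++ List.replicate Z 0).map encodeNat = Lf.map encodeNat ++ List.replicate Z [] := by
    simp [List.map_append, List.map_replicate, show encodeNat 0 = [] from rfl]
  have hWr := runs_blWrap h hn (dst := .g .BF) (by decide) (by decide) (hSt h T { uE with u1 := [], l4 := outRev (Lf.map encodeNat ++ List.replicate Z []) })
    (B := Lf ++ List.replicate Z 0) hpadN (by simp [hmapE]) (by simp [uE, uD, uC, uB, uA, st, hx3])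
  rw [hpadl] at hWr
  refine (hL.seq (hB.seq (hC.seq (hD.seq (hE.seq (hZr.seq hWr)))))).of_eq ?_ ?_
  · simp [uE, uD, uC, uB, uA, st, hbf, hpad, hx3, hx4, hx5, hu1, hl4, encVec]
  · simp only [blFPassCost, List.map_const', List.sum_replicate, smul_eq_mul, ← hc3]
    have hZk : Z ≤ 2 ^ k := Nat.sub_le _ _
    have h2k0 := Nat.two_pow_pos k
    have e1 : 2 ^ k * (2 * c + 2) = 2 * (2 ^ k * c) + 2 * 2 ^ k := by ring
    have e2' : 2 ^ k * (2 * n) = 2 * (2 ^ k * n) := by ring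
    have e3 : 2 ^ k * (n + 1) = 2 ^ k * n + 2 ^ k := by ring
    have hkc : 2 ^ k ≤ 2 ^ k * c := Nat.le_mul_of_pos_right _ (by omega)
    rw [e1, e2', e3]
    omega



/-- `C(x,2) = (x² − x)/2`. [folklore] -/
theorem choose_two_eq_sq_sub (x : ℕ) : x.choose 2 = (x * x - x) / 2 := by
  rw [Nat.choose_two_right, Nat.mul_sub_one]

/-- Segment one of `g'`: `s < d ≤ n₁`, exponent `E − C(n₁ − s, 2)`. [folklore] -/
def blG1 (N α E n₁ d : ℕ) : List ℕ := (List.range d).map fun s => α ^ (E - ((n₁ - s) * (n₁ - s) - (n₁ - s)) / 2) % N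

/-- Segment two of `g'`: `t' < d`, exponent `E − C(t' + 1, 2)`. [folklore] -/
def blG2 (N α E d : ℕ) : List ℕ := (List.range d).map fun t => α ^ (E - ((t + 1) * (t + 1) - (t + 1)) / 2) % N

/-- `blG1_succ`. [folklore] -/
theorem blG1_succ (N α E n₁ d : ℕ) : blG1 N α E n₁ (d + 1) = blG1 N α E n₁ d ++ [α ^ (E - ((n₁ - d) * (n₁ - d) - (n₁ - d)) / 2) % N] := by
  simp [blG1, List.range_succ]

/-- `blG2_succ`. [folklore] -/
theorem blG2_succ (N α E d : ℕ) : blG2 N α E (d + 1) = blG2 N α E d ++ [α ^ (E - ((d + 1) * (d + 1) - (d + 1)) / 2) % N] := by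
  simp [blG2, List.range_succ]

/-- The two segments are the shifted chirp. [folklore] -/
theorem blG1_append_blG2 (N α E n₁ m : ℕ) (hn₁ : 1 ≤ n₁) (hm : 1 ≤ m) :
    blG1 N α E n₁ n₁ ++ blG2 N α E (m - 1) = NegFFT.chirpG N α (n₁ - 1) m E := by
  have hsplit : n₁ - 1 + m = n₁ + (m - 1) := by omega
  rw [NegFFT.chirpG, hsplit, List.range_add, List.map_append, List.map_map]
  congr 1
  · refine List.map_congr_left fun s hs => ?_
    rw [List.mem_range] at hs
    unfold Literature.Computability.AlgebraicComplexity.chirpExp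
    split_ifs with h1
    · have : s = n₁ - 1 := by omega
      subst this
      simp [show n₁ - (n₁ - 1) = 1 by omega]
    · rw [choose_two_eq_sq_sub, show n₁ - 1 - s + 1 = n₁ - s by omega]
  · refine List.map_congr_left fun t ht => ?_
    simp only [Function.comp]
    unfold Literature.Computability.AlgebraicComplexity.chirpExp
    rw [if_pos (by omega), choose_two_eq_sq_sub, show n₁ + t - (n₁ - 1) = t + 1 by omega]

/-- Segment-one element: `d = n₁ − s`, `C(d,2)`, `E − C(d,2)`, `powMod`, counter, emit. [folklore] -/
def blGBody1 : Com (EReg ⊕ β) :=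
  ((NS.ofList [.sub (h .X4) (h .BLC1) (h .BLC2), .mul (h .X5) (h .X4) (h .X4), .sub (h .X6) (h .X5) (h .X4), .clear (h .X5),
      .divMod (h .X5) (h .X2) (h .X6) (h .BLPOW), .clear (h .X2), .clear (h .X6), .sub (h .X6) (h .BLE) (h .X5), .clear (h .X5),
      .powMod (h .X5) (h .BLA) (h .X6) (h (.g (.f (.n (.v .MD))))), .clear (h .X6), .clear (h .X4), .succ (h .X4) (h .BLC2), .clear (h .BLC2),
      .move (h .X4) (h .BLC2)] : NS β).com) ;;
  emit (Sum.inr (h .X5)) (Sum.inr (h .L4))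

/-- Segment-two element: `t = BLC2`, `C(t,2)`, `E − C(t,2)`, `powMod`, counter, emit. [folklore] -/
def blGBody2 : Com (EReg ⊕ β) :=
  ((NS.ofList [.mul (h .X5) (h .BLC2) (h .BLC2), .sub (h .X6) (h .X5) (h .BLC2), .clear (h .X5),
      .divMod (h .X5) (h .X2) (h .X6) (h .BLPOW), .clear (h .X2), .clear (h .X6), .sub (h .X6) (h .BLE) (h .X5), .clear (h .X5),
      .powMod (h .X5) (h .BLA) (h .X6) (h (.g (.f (.n (.v .MD))))), .clear (h .X6), .succ (h .X4) (h .BLC2), .clear (h .BLC2),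
      .move (h .X4) (h .BLC2)] : NS β).com) ;;
  emit (Sum.inr (h .X5)) (Sum.inr (h .L4))

/-- The exponent shift `E = C(n₁,2) + C(m,2)` into `BLE`. [folklore] -/
def blESet : NS β :=
  NS.ofList [.mul (h .X4) (h .BLC1) (h .BLC1), .sub (h .X5) (h .X4) (h .BLC1), .clear (h .X4), .divMod (h .BLE) (h .X2) (h .X5) (h .BLPOW),
    .clear (h .X2), .clear (h .X5), .mul (h .X4) (h .BLM) (h .BLM), .sub (h .X5) (h .X4) (h .BLM), .clear (h .X4),
    .divMod (h .X6) (h .X2) (h .X5) (h .BLPOW), .clear (h .X2), .clear (h .X5), .add (h .X2) (h .BLE) (h .X6), .clear (h .BLE), .clear (h .X6),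
    .move (h .X2) (h .BLE)]

/-- Segment one with its set-up: `E`, the unary count `n₁`, the loop. [folklore] -/
def blGSeg1 : Com (EReg ⊕ β) :=
  (blESet h).com ;; (nToUnary (h .U1) (h .BLC1) ;; countLoop (Sum.inr (h .U1)) (blGBody1 h))

/-- Segment two with its set-up: counter to `1`, the unary count `m − 1`, the loop. [folklore] -/
def blGSeg2 : Com (EReg ⊕ β) :=
  ((NS.ofList [.const (h .X2) (encodeNat 1), .sub (h .X4) (h .BLM) (h .X2), .clear (h .X2), .clear (h .BLC2), .const (h .BLC2) (encodeNat 1)] : NS β).com) ;;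
  (nToUnary (h .U1) (h .X4) ;; (((NS.op (.clear (h .X4))) : NS β).com ;; countLoop (Sum.inr (h .U1)) (blGBody2 h)))

/-- Padding of the `g'` accumulator to `2^k` entries and wrapping onto `BG`. [folklore] -/
def blGPad : Com (EReg ⊕ β) :=
  pow2Into (rGH h) (h .X4) (h .BLK) ;;
  (((NS.ofList [.add (h .X5) (h .BLC1) (h .BLM), .const (h .X2) (encodeNat 1), .sub (h .X6) (h .X5) (h .X2), .clear (h .X5), .clear (h .X2),
      .sub (h .X5) (h .X4) (h .X6), .clear (h .X4), .clear (h .X6), .clear (h .BLC2)] : NS β).com) ;;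
  (nToUnary (h .U1) (h .X5) ;; (((NS.op (.clear (h .X5))) : NS β).com ;; (blZeros h ;; blWrap h (.g .BG)))))

/-- The `g'` pass. [folklore] -/
def blGPass : Com (EReg ⊕ β) := blGSeg1 h ;; (blGSeg2 h ;; blGPad h)

/-- Unary conversion cost bound used throughout. [folklore] -/
theorem toUnary_cost_le {x k : ℕ} (hx : x ≤ 2 ^ k) : (encodeNat x).length * (16 * x + 21) + 5 ≤ (k + 1) * (16 * 2 ^ k + 21) + 5 :=
  Nat.add_le_add_right (Nat.mul_le_mul ((Brick.length_encodeNat_mono hx).trans (by rw [encodeNat_two_pow]; simp)) (by omega)) _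

/-- The exponent shift is below `2^{2k}`. [folklore] -/
theorem blE_le {k n₁ m : ℕ} (hk : 1 ≤ k) (hn₁k : n₁ ≤ 2 ^ (k - 1)) (hmk : m ≤ 2 ^ (k - 1)) : n₁.choose 2 + m.choose 2 ≤ 2 ^ (2 * k) := by
  have hCle : ∀ x : ℕ, x.choose 2 ≤ x * x := fun x => by
    rw [choose_two_eq_sq_sub]; exact (Nat.div_le_self _ _).trans (Nat.sub_le _ _)
  have h1 := hCle n₁; have h2 := hCle m
  have h3 := Nat.mul_le_mul hn₁k hn₁k; have h4 := Nat.mul_le_mul hmk hmk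
  have hr2 : 2 * (2 ^ (k - 1) * 2 ^ (k - 1)) ≤ 2 ^ (2 * k) := by
    rw [← pow_add, ← pow_succ']; exact Nat.pow_le_pow_right (by omega) (by omega)
  calc n₁.choose 2 + m.choose 2 ≤ n₁ * n₁ + m * m := Nat.add_le_add h1 h2
    _ ≤ 2 ^ (k - 1) * 2 ^ (k - 1) + 2 ^ (k - 1) * 2 ^ (k - 1) := Nat.add_le_add h3 h4
    _ ≤ 2 ^ (2 * k) := by rw [← two_mul]; exact hr2

/-- Numerals below `2^{2k}` fit the size bound. [folklore] -/
theorem length_le_of_le_two_pow_two_mul {x k n : ℕ} (hx : x ≤ 2 ^ (2 * k)) (hkn : 2 * k + 4 ≤ n) : (encodeNat x).length ≤ n :=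
  (Brick.length_encodeNat_mono hx).trans (by rw [encodeNat_two_pow]; simp; omega)

/-- Cost of segment one. [folklore] -/
def blGSeg1Cost (n k : ℕ) (n₁ : ℕ) : ℕ := 1479 * (n + 1) ^ 3 + ((k + 1) * (16 * 2 ^ k + 21) + 5) + (n₁ * (2900 * (n + 1) ^ 3 + 2) + 1)

/-- **Segment one of the `g'` pass.** [folklore] -/
theorem runs_blGSeg1 {N n k α n₁ m : ℕ} (hN1 : 1 < N) (hn : (encodeNat N).length + 1 ≤ n) (hk : 1 ≤ k) (hkn : 2 * k + 4 ≤ n) (T : Regs β) (hI : DrvInv (rGH h) N T)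
    (u : HSlots) (hn₁k : n₁ ≤ 2 ^ (k - 1)) (hmk : m ≤ 2 ^ (k - 1)) (hαN : α < N)
    (hbla : u.bla = encodeNat α) (hblpow : u.blpow = encodeNat 2) (hblc1 : u.blc1 = encodeNat n₁) (hblm : u.blm = encodeNat m)
    (hble : u.ble = []) (hblc2 : u.blc2 = []) (hx2 : u.x2 = []) (hx4 : u.x4 = []) (hx5 : u.x5 = []) (hx6 : u.x6 = []) (hu1 : u.u1 = []) (hl4 : u.l4 = []) :
    Runs (blGSeg1 h) (base (hSt h T u))
      (base (hSt h T { u with ble := encodeNat (n₁.choose 2 + m.choose 2), blc2 := encodeNat n₁,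
                              l4 := outRev ((blG1 N α (n₁.choose 2 + m.choose 2) n₁ n₁).map encodeNat) })) (blGSeg1Cost n k n₁) := by
  have hhq : ∀ {i j : HReg}, i ≠ j → h i ≠ h j := fun hij => hq_ne h hij
  obtain ⟨hMD, -, -, -, -, -, -, -, -, -, -, -, -, -, -, -, -, -⟩ := hI
  have hN0 : 0 < N := by omega
  set c := (n + 1) ^ 3 with hc3
  have hc1 : n + 1 ≤ c := by
    rw [hc3]; calc n + 1 = (n + 1) ^ 1 := (pow_one _).symm
      _ ≤ (n + 1) ^ 3 := Nat.pow_le_pow_right (by omega) (by omega)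
  have rdMD : ∀ u' : HSlots, hSt h T u' (h (.g (.f (.n (.v .MD))))) = encodeNat N := fun u' => by
    rw [hSt_gv h T u' (by decide) (by decide) (by decide) (by decide) (by decide) (by decide)]; exact hMD
  have hlN : (encodeNat N).length ≤ n := by omega
  have hlα : (encodeNat α).length ≤ n := (Brick.length_encodeNat_mono hαN.le).trans hlN
  have e2 : encodeNat 2 = [false, true] := by simpa using encodeNat_two_pow 1
  have hl2' : (encodeNat 2).length ≤ n := by rw [e2]; simp only [List.length_cons, List.length_nil]; omega
  have hk1 : 2 ^ (k - 1) ≤ 2 ^ k := Nat.pow_le_pow_right (by omega) (by omega)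
  have hkk : 2 ^ (k - 1) * 2 ^ (k - 1) ≤ 2 ^ (2 * k) := by rw [← pow_add]; exact Nat.pow_le_pow_right (by omega) (by omega)
  have hl2k : ∀ x, x ≤ 2 ^ (2 * k) → (encodeNat x).length ≤ n := fun x hx => length_le_of_le_two_pow_two_mul hx hkn
  set E := n₁.choose 2 + m.choose 2 with hE0
  have hsub : ∀ x : ℕ, x ≤ x * x := fun x => by nlinarith
  have hsq : ∀ x : ℕ, x ≤ 2 ^ (k - 1) → x * x ≤ 2 ^ (2 * k) := fun x hx => (Nat.mul_le_mul hx hx).trans hkk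
  have hx2k : ∀ x : ℕ, x ≤ 2 ^ (k - 1) → x ≤ 2 ^ (2 * k) := fun x hx => hx.trans ((hsub _).trans hkk)
  have hE2k : E ≤ 2 ^ (2 * k) := blE_le hk hn₁k hmk
  have hCmono : ∀ x y : ℕ, x ≤ y → x.choose 2 ≤ y.choose 2 := fun x y hxy => Nat.choose_le_choose 2 hxy
  have hCq : ∀ x : ℕ, (x * x - x) / 2 = x.choose 2 := fun x => (choose_two_eq_sq_sub x).symm
  have hln₁ : (encodeNat n₁).length ≤ n := hl2k _ (hx2k _ hn₁k)
  have hlm : (encodeNat m).length ≤ n := hl2k _ (hx2k _ hmk)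
  have hlE : (encodeNat E).length ≤ n := hl2k _ hE2k
  have hlpow : ∀ e, (encodeNat (α ^ e % N)).length ≤ n := fun e => (Brick.length_encodeNat_mono (Nat.mod_lt _ hN0).le).trans hlN
  -- E
  let uE1 : HSlots := { u with ble := encodeNat E }
  have hEs : Runs (blESet h).com (base (hSt h T u)) (base (hSt h T uE1)) (1479 * c) := by
    have hq1 := hsq n₁ hn₁k; have hq2 := hsq m hmk
    have hl1 := hl2k _ hq1; have hl2 := hl2k _ hq2
    have hl3 : (encodeNat (n₁ * n₁ - n₁)).length ≤ n := hl2k _ ((Nat.sub_le _ _).trans hq1)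
    have hl4' : (encodeNat (m * m - m)).length ≤ n := hl2k _ ((Nat.sub_le _ _).trans hq2)
    have hl5 : (encodeNat ((n₁ * n₁ - n₁) / 2)).length ≤ n := hl2k _ ((Nat.div_le_self _ _).trans ((Nat.sub_le _ _).trans hq1))
    have hl6 : (encodeNat ((m * m - m) / 2)).length ≤ n := hl2k _ ((Nat.div_le_self _ _).trans ((Nat.sub_le _ _).trans hq2))
    have hl7 : (encodeNat ((n₁ * n₁ - n₁) % 2)).length ≤ n :=
      hl2k _ (by have := Nat.mod_lt (n₁ * n₁ - n₁) (show 0 < 2 by omega); have := Nat.one_le_two_pow (n := 2 * k); omega)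
    have hl8 : (encodeNat ((m * m - m) % 2)).length ≤ n :=
      hl2k _ (by have := Nat.mod_lt (m * m - m) (show 0 < 2 by omega); have := Nat.one_le_two_pow (n := 2 * k); omega)
    have hl9 : (encodeNat ((n₁ * n₁ - n₁) / 2 + (m * m - m) / 2)).length ≤ n := by rw [hCq, hCq]; exact hlE
    refine NS.runs_of_eq (N := n) _ _ ?_ ?_ (by simp [hc3, blESet])
    · simp (config := { decide := true }) only [blESet, NS.ofList, NS.ok, NOp.ok, NS.eval, NOp.eval, hSt_X2, hSt_X4, hSt_X5, hSt_X6, hSt_BLC1, hSt_BLM,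
        hSt_BLE, hSt_BLPOW, update_hSt_X2, update_hSt_X4, update_hSt_X5, update_hSt_X6, update_hSt_BLE, hx2, hx4, hx5, hx6, hble, hblc1, hblm, hblpow,
        bitsToNat_encodeNat, ne_eq, EmbeddingLike.apply_eq_iff_eq, List.length_nil, zero_le, and_self, hln₁, hlm, hl1, hl2, hl3,
        hl4', hl5, hl6, hl7, hl8, hl9, hl2', hsub, not_false_eq_true, Nat.ofNat_pos]
    · simp [blESet, uE1, hx2, hx4, hx5, hx6, hble, hblc1, hblm, hblpow, hE0, hCq]
  -- segment one
  let g1st : ℕ → HSlots := fun i => { uE1 with u1 := List.replicate i true, blc2 := encodeNat (n₁ - i), l4 := outRev ((blG1 N α E n₁ (n₁ - i)).map encodeNat) }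
  have hbody1 : ∀ i, i + 1 ≤ n₁ → Runs (blGBody1 h) (base (hSt h T { g1st (i + 1) with u1 := List.replicate i true })) (base (hSt h T (g1st i))) (2900 * c) := by
    intro i hi
    have hs : n₁ - (n₁ - (i + 1)) = (i + 1) := Nat.sub_sub_self hi
    have hs1 : n₁ - (i + 1) + 1 = n₁ - i := by omega
    have hdk : (i + 1) ≤ 2 ^ (k - 1) := hi.trans hn₁k
    have hdd := hsq (i + 1) hdk
    have hl1 : (encodeNat (n₁ - (i + 1))).length ≤ n := hl2k _ ((Nat.sub_le _ _).trans (hx2k _ hn₁k))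
    have hl1' : (encodeNat (n₁ - i)).length ≤ n := hl2k _ ((Nat.sub_le _ _).trans (hx2k _ hn₁k))
    have hl2 : (encodeNat (i + 1)).length ≤ n := hl2k _ (hx2k _ hdk)
    have hl3 : (encodeNat ((i + 1) * (i + 1))).length ≤ n := hl2k _ hdd
    have hl4' : (encodeNat ((i + 1) * (i + 1) - (i + 1))).length ≤ n := hl2k _ ((Nat.sub_le _ _).trans hdd)
    have hl5 : (encodeNat (((i + 1) * (i + 1) - (i + 1)) / 2)).length ≤ n := hl2k _ ((Nat.div_le_self _ _).trans ((Nat.sub_le _ _).trans hdd))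
    have hl6 : (encodeNat (((i + 1) * (i + 1) - (i + 1)) % 2)).length ≤ n :=
      hl2k _ (by have := Nat.mod_lt ((i + 1) * (i + 1) - (i + 1)) (show 0 < 2 by omega); have := Nat.one_le_two_pow (n := 2 * k); omega)
    have hCE : ((i + 1) * (i + 1) - (i + 1)) / 2 ≤ E := by rw [hCq, hE0]; exact (hCmono _ _ hi).trans (Nat.le_add_right _ _)
    have hl7 : (encodeNat (E - ((i + 1) * (i + 1) - (i + 1)) / 2)).length ≤ n := hl2k _ ((Nat.sub_le _ _).trans hE2k)
    have hl8 := hlpow (E - ((i + 1) * (i + 1) - (i + 1)) / 2)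
    let ua : HSlots := { g1st (i + 1) with u1 := List.replicate i true }
    let ub : HSlots := { ua with blc2 := encodeNat (n₁ - i), x5 := encodeNat (α ^ (E - ((i + 1) * (i + 1) - (i + 1)) / 2) % N) }
    have h1 : Runs ((NS.ofList [.sub (h .X4) (h .BLC1) (h .BLC2), .mul (h .X5) (h .X4) (h .X4), .sub (h .X6) (h .X5) (h .X4), .clear (h .X5),
        .divMod (h .X5) (h .X2) (h .X6) (h .BLPOW), .clear (h .X2), .clear (h .X6), .sub (h .X6) (h .BLE) (h .X5), .clear (h .X5),
        .powMod (h .X5) (h .BLA) (h .X6) (h (.g (.f (.n (.v .MD))))), .clear (h .X6), .clear (h .X4), .succ (h .X4) (h .BLC2), .clear (h .BLC2),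
        .move (h .X4) (h .BLC2)] : NS β).com) (base (hSt h T ua)) (base (hSt h T ub)) (2834 * c) := by
      refine NS.runs_of_eq (N := n) _ _ ?_ ?_ (by simp [hc3])
      · simp (config := { decide := true }) only [NS.ofList, NS.ok, NOp.ok, NS.eval, NOp.eval, hSt_X2, hSt_X4, hSt_X5, hSt_X6, hSt_BLC1, hSt_BLC2,
          hSt_BLE, hSt_BLPOW, hSt_BLA, update_hSt_X2, update_hSt_X4, update_hSt_X5, update_hSt_X6, update_hSt_BLC2, ua, g1st, uE1, hx2, hx4, hx5, hx6,
          hblc1, hbla, hblpow, rdMD, bitsToNat_encodeNat, ne_eq, EmbeddingLike.apply_eq_iff_eq, List.length_nil, zero_le, and_self,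
          hs, hs1, hln₁, hl1, hl1', hl2, hl3, hl4', hl5, hl6, hl7, hlE, hlα, hlN, hl2', hsub, hCE, hN1, Nat.sub_le, not_false_eq_true, Nat.ofNat_pos]
      · simp [ua, ub, g1st, uE1, hx2, hx4, hx5, hx6, hblc1, hbla, hblpow, rdMD, hs, hs1]
    have h2 : Runs (emit (Sum.inr (h .X5)) (Sum.inr (h .L4))) (base (hSt h T ub)) (base (hSt h T (g1st i))) (4 * n + 3) := by
      refine (runs_emit (h := (Sum.inr (h .X5) : EReg ⊕ β)) (o := Sum.inr (h .L4)) (by simp [hhq]) (base (hSt h T ub))).of_eq ?_ ?_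
      · simp [ub, ua, g1st, uE1, hx5, ← hs1, blG1_succ, hs, List.map_append, outRev_append]
      · simp only [nst_inr, hSt_X5, ub]; omega
    exact (h1.seq h2).of_eq rfl (by omega)
  have hn₁k' : n₁ ≤ 2 ^ k := hn₁k.trans hk1
  have hU1 : Runs (nToUnary (h .U1) (h .BLC1)) (base (hSt h T uE1)) (base (hSt h T { uE1 with u1 := List.replicate n₁ true })) ((k + 1) * (16 * 2 ^ k + 21) + 5) := by
    refine (runs_nToUnary (h .U1) (h .BLC1) (hSt h T uE1) (by simp [uE1, hu1])).of_eq ?_ ?_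
    · simp [uE1, hblc1]
    · simp only [hSt_BLC1, uE1, hblc1, bitsToNat_encodeNat]; exact toUnary_cost_le hn₁k'
  have hL1 := runs_countLoop (U := (Sum.inr (h .U1) : EReg ⊕ β)) (body := blGBody1 h) (fun i R => i ≤ n₁ ∧ R = base (hSt h T (g1st i))) (2900 * c)
    (by
      rintro i R ⟨hi, rfl⟩ -
      have : Function.update (base (hSt h T (g1st (i + 1)))) (Sum.inr (h .U1)) (List.replicate i true) = base (hSt h T { g1st (i + 1) with u1 := List.replicate i true }) := by
        simp [g1st]
      rw [this]
      exact ⟨_, hbody1 i hi, by simp [g1st], by omega, rfl⟩)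
    n₁ (base (hSt h T { uE1 with u1 := List.replicate n₁ true })) ⟨le_rfl, by simp [g1st, uE1, hblc2, hl4, blG1, show encodeNat 0 = [] from rfl]⟩ (by simp [uE1])
  obtain ⟨R1, hR1, -, -, rfl⟩ := hL1
  refine (hEs.seq (hU1.seq hR1)).of_eq ?_ ?_
  · simp [g1st, uE1, hu1, hE0]
  · simp only [blGSeg1Cost, ← hc3]; omega

/-- Cost of segment two. [folklore] -/
def blGSeg2Cost (n k : ℕ) (m : ℕ) : ℕ := 88 * (n + 1) ^ 3 + ((k + 1) * (16 * 2 ^ k + 21) + 5) + ((m - 1) * (2900 * (n + 1) ^ 3 + 2) + 1)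

/-- **Segment two of the `g'` pass.** [folklore] -/
theorem runs_blGSeg2 {N n k α n₁ m : ℕ} (hN1 : 1 < N) (hn : (encodeNat N).length + 1 ≤ n) (hk : 1 ≤ k) (hkn : 2 * k + 4 ≤ n) (T : Regs β) (hI : DrvInv (rGH h) N T)
    (u : HSlots) (hn₁k : n₁ ≤ 2 ^ (k - 1)) (hm : 1 ≤ m) (hmk : m ≤ 2 ^ (k - 1)) (hαN : α < N)
    (hbla : u.bla = encodeNat α) (hblpow : u.blpow = encodeNat 2) (hblm : u.blm = encodeNat m)
    (hble : u.ble = encodeNat (n₁.choose 2 + m.choose 2)) (hblc2 : u.blc2 = encodeNat n₁)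
    (hx2 : u.x2 = []) (hx4 : u.x4 = []) (hx5 : u.x5 = []) (hx6 : u.x6 = []) (hu1 : u.u1 = []) (L0 : List (List Bool)) (hl4 : u.l4 = outRev L0) :
    Runs (blGSeg2 h) (base (hSt h T u))
      (base (hSt h T { u with blc2 := encodeNat m, l4 := outRev (L0 ++ (blG2 N α (n₁.choose 2 + m.choose 2) (m - 1)).map encodeNat) })) (blGSeg2Cost n k m) := by
  have hhq : ∀ {i j : HReg}, i ≠ j → h i ≠ h j := fun hij => hq_ne h hij
  obtain ⟨hMD, -, -, -, -, -, -, -, -, -, -, -, -, -, -, -, -, -⟩ := hI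
  have hN0 : 0 < N := by omega
  set c := (n + 1) ^ 3 with hc3
  have hc1 : n + 1 ≤ c := by
    rw [hc3]; calc n + 1 = (n + 1) ^ 1 := (pow_one _).symm
      _ ≤ (n + 1) ^ 3 := Nat.pow_le_pow_right (by omega) (by omega)
  have rdMD : ∀ u' : HSlots, hSt h T u' (h (.g (.f (.n (.v .MD))))) = encodeNat N := fun u' => by
    rw [hSt_gv h T u' (by decide) (by decide) (by decide) (by decide) (by decide) (by decide)]; exact hMD
  have hlN : (encodeNat N).length ≤ n := by omega
  have hlα : (encodeNat α).length ≤ n := (Brick.length_encodeNat_mono hαN.le).trans hlN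
  have e2 : encodeNat 2 = [false, true] := by simpa using encodeNat_two_pow 1
  have e1 : encodeNat 1 = [true] := by simpa using encodeNat_two_pow 0
  have hl2' : (encodeNat 2).length ≤ n := by rw [e2]; simp only [List.length_cons, List.length_nil]; omega
  have hl1n : (encodeNat 1).length ≤ n := by rw [e1]; simp only [List.length_cons, List.length_nil]; omega
  have hk1 : 2 ^ (k - 1) ≤ 2 ^ k := Nat.pow_le_pow_right (by omega) (by omega)
  have hkk : 2 ^ (k - 1) * 2 ^ (k - 1) ≤ 2 ^ (2 * k) := by rw [← pow_add]; exact Nat.pow_le_pow_right (by omega) (by omega)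
  have hl2k : ∀ x, x ≤ 2 ^ (2 * k) → (encodeNat x).length ≤ n := fun x hx => length_le_of_le_two_pow_two_mul hx hkn
  set E := n₁.choose 2 + m.choose 2 with hE0
  have hsub : ∀ x : ℕ, x ≤ x * x := fun x => by nlinarith
  have hsq : ∀ x : ℕ, x ≤ 2 ^ (k - 1) → x * x ≤ 2 ^ (2 * k) := fun x hx => (Nat.mul_le_mul hx hx).trans hkk
  have hx2k : ∀ x : ℕ, x ≤ 2 ^ (k - 1) → x ≤ 2 ^ (2 * k) := fun x hx => hx.trans ((hsub _).trans hkk)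
  have hE2k : E ≤ 2 ^ (2 * k) := blE_le hk hn₁k hmk
  have hCmono : ∀ x y : ℕ, x ≤ y → x.choose 2 ≤ y.choose 2 := fun x y hxy => Nat.choose_le_choose 2 hxy
  have hCq : ∀ x : ℕ, (x * x - x) / 2 = x.choose 2 := fun x => (choose_two_eq_sq_sub x).symm
  have hln₁ : (encodeNat n₁).length ≤ n := hl2k _ (hx2k _ hn₁k)
  have hlm : (encodeNat m).length ≤ n := hl2k _ (hx2k _ hmk)
  have hlm1 : (encodeNat (m - 1)).length ≤ n := hl2k _ ((Nat.sub_le _ _).trans (hx2k _ hmk))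
  have hlE : (encodeNat E).length ≤ n := hl2k _ hE2k
  have hlpow : ∀ e, (encodeNat (α ^ e % N)).length ≤ n := fun e => (Brick.length_encodeNat_mono (Nat.mod_lt _ hN0).le).trans hlN
  have hmk' : m ≤ 2 ^ k := hmk.trans hk1
  let g2st : ℕ → HSlots := fun i => { u with u1 := List.replicate i true, x4 := [], blc2 := encodeNat (m - i), l4 := outRev (L0 ++ (blG2 N α E (m - 1 - i)).map encodeNat) }
  have hT2 : Runs ((NS.ofList [.const (h .X2) (encodeNat 1), .sub (h .X4) (h .BLM) (h .X2), .clear (h .X2), .clear (h .BLC2), .const (h .BLC2) (encodeNat 1)] : NS β).com)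
      (base (hSt h T u)) (base (hSt h T { u with x4 := encodeNat (m - 1), blc2 := encodeNat 1 })) (85 * c) := by
    refine NS.runs_of_eq (N := n) _ _ ?_ ?_ (by simp [hc3])
    · simp (config := { decide := true }) only [NS.ofList, NS.ok, NOp.ok, NS.eval, NOp.eval, hSt_X2, hSt_X4, hSt_BLC2, hSt_BLM, update_hSt_X2, update_hSt_X4,
        update_hSt_BLC2, hx2, hx4, hblm, hblc2, bitsToNat_encodeNat, List.length_nil, zero_le, and_self, hl1n, hlm, hln₁, hm]
    · simp [hx2, hx4, hblm]
  have hU2 : Runs (nToUnary (h .U1) (h .X4)) (base (hSt h T { u with x4 := encodeNat (m - 1), blc2 := encodeNat 1 }))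
      (base (hSt h T { u with x4 := encodeNat (m - 1), blc2 := encodeNat 1, u1 := List.replicate (m - 1) true })) ((k + 1) * (16 * 2 ^ k + 21) + 5) := by
    refine (runs_nToUnary (h .U1) (h .X4) (hSt h T { u with x4 := encodeNat (m - 1), blc2 := encodeNat 1 }) (by simp [hu1])).of_eq ?_ ?_
    · simp
    · simp only [hSt_X4, bitsToNat_encodeNat]; exact toUnary_cost_le ((Nat.sub_le _ _).trans hmk')
  have hC2 : Runs (NS.op (.clear (h .X4)) : NS β).com (base (hSt h T { u with x4 := encodeNat (m - 1), blc2 := encodeNat 1, u1 := List.replicate (m - 1) true }))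
      (base (hSt h T (g2st (m - 1)))) (3 * c) := by
    refine NS.runs_of_eq (N := n) _ _ (by simp only [NS.ok, NOp.ok, hSt_X4]; exact hlm1) ?_ (by simp [hc3])
    simp [g2st, show m - (m - 1) = 1 by omega, blG2, hl4]
  -- segment two
  have hbody2 : ∀ i, i + 1 ≤ m - 1 → Runs (blGBody2 h) (base (hSt h T { g2st (i + 1) with u1 := List.replicate i true })) (base (hSt h T (g2st i))) (2900 * c) := by
    intro i hi
    have ht1 : m - 1 - (i + 1) + 1 = m - (i + 1) := by omega
    have ht2 : m - (i + 1) + 1 = m - i := by omega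
    have ht3 : m - 1 - i = m - 1 - (i + 1) + 1 := by omega
    have htk : m - (i + 1) ≤ 2 ^ (k - 1) := (Nat.sub_le _ _).trans hmk
    have hdd := hsq (m - (i + 1)) htk
    have hl1 : (encodeNat (m - (i + 1))).length ≤ n := hl2k _ (hx2k _ htk)
    have hl1' : (encodeNat (m - i)).length ≤ n := hl2k _ ((Nat.sub_le _ _).trans (hx2k _ hmk))
    have hl3 : (encodeNat ((m - (i + 1)) * (m - (i + 1)))).length ≤ n := hl2k _ hdd
    have hl4' : (encodeNat ((m - (i + 1)) * (m - (i + 1)) - (m - (i + 1)))).length ≤ n := hl2k _ ((Nat.sub_le _ _).trans hdd)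
    have hl5 : (encodeNat (((m - (i + 1)) * (m - (i + 1)) - (m - (i + 1))) / 2)).length ≤ n :=
      hl2k _ ((Nat.div_le_self _ _).trans ((Nat.sub_le _ _).trans hdd))
    have hl6 : (encodeNat (((m - (i + 1)) * (m - (i + 1)) - (m - (i + 1))) % 2)).length ≤ n :=
      hl2k _ (by have := Nat.mod_lt ((m - (i + 1)) * (m - (i + 1)) - (m - (i + 1))) (show 0 < 2 by omega); have := Nat.one_le_two_pow (n := 2 * k); omega)
    have hCE : ((m - (i + 1)) * (m - (i + 1)) - (m - (i + 1))) / 2 ≤ E := by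
      rw [hCq, hE0]; exact (hCmono _ _ (Nat.sub_le _ _)).trans (Nat.le_add_left _ _)
    have hl7 : (encodeNat (E - ((m - (i + 1)) * (m - (i + 1)) - (m - (i + 1))) / 2)).length ≤ n := hl2k _ ((Nat.sub_le _ _).trans hE2k)
    have hl8 := hlpow (E - ((m - (i + 1)) * (m - (i + 1)) - (m - (i + 1))) / 2)
    let ua : HSlots := { g2st (i + 1) with u1 := List.replicate i true }
    let ub : HSlots := { ua with x4 := [], blc2 := encodeNat (m - i), x5 := encodeNat (α ^ (E - ((m - (i + 1)) * (m - (i + 1)) - (m - (i + 1))) / 2) % N) }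
    have h1 : Runs ((NS.ofList [.mul (h .X5) (h .BLC2) (h .BLC2), .sub (h .X6) (h .X5) (h .BLC2), .clear (h .X5),
        .divMod (h .X5) (h .X2) (h .X6) (h .BLPOW), .clear (h .X2), .clear (h .X6), .sub (h .X6) (h .BLE) (h .X5), .clear (h .X5),
        .powMod (h .X5) (h .BLA) (h .X6) (h (.g (.f (.n (.v .MD))))), .clear (h .X6), .succ (h .X4) (h .BLC2), .clear (h .BLC2),
        .move (h .X4) (h .BLC2)] : NS β).com) (base (hSt h T ua)) (base (hSt h T ub)) (2760 * c) := by
      refine NS.runs_of_eq (N := n) _ _ ?_ ?_ (by simp [hc3])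
      · simp (config := { decide := true }) only [NS.ofList, NS.ok, NOp.ok, NS.eval, NOp.eval, hSt_X2, hSt_X4, hSt_X5, hSt_X6, hSt_BLC2,
          hSt_BLE, hSt_BLPOW, hSt_BLA, update_hSt_X2, update_hSt_X4, update_hSt_X5, update_hSt_X6, update_hSt_BLC2, ua, g2st, hx2, hx5, hx6,
          hbla, hblpow, hble, rdMD, bitsToNat_encodeNat, ne_eq, EmbeddingLike.apply_eq_iff_eq, List.length_nil, zero_le, and_self,
          ht2, hl1, hl1', hl3, hl4', hl5, hl6, hl7, hlE, hlα, hlN, hl2', hsub, hCE, hN1, not_false_eq_true, Nat.ofNat_pos]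
      · simp [ua, ub, g2st, hx2, hx5, hx6, hbla, hblpow, hble, rdMD, ht2]
    have h2 : Runs (emit (Sum.inr (h .X5)) (Sum.inr (h .L4))) (base (hSt h T ub)) (base (hSt h T (g2st i))) (4 * n + 3) := by
      refine (runs_emit (h := (Sum.inr (h .X5) : EReg ⊕ β)) (o := Sum.inr (h .L4)) (by simp [hhq]) (base (hSt h T ub))).of_eq ?_ ?_
      · simp only [ub, ua, g2st]
        rw [ht3, blG2_succ, ht1]
        simp [hx5, List.map_append, outRev_append, ← List.append_assoc]
      · simp only [nst_inr, hSt_X5, ub]; omega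
    exact (h1.seq h2).of_eq rfl (by omega)
  have hL2 := runs_countLoop (U := (Sum.inr (h .U1) : EReg ⊕ β)) (body := blGBody2 h) (fun i R => i ≤ m - 1 ∧ R = base (hSt h T (g2st i))) (2900 * c)
    (by
      rintro i R ⟨hi, rfl⟩ -
      have : Function.update (base (hSt h T (g2st (i + 1)))) (Sum.inr (h .U1)) (List.replicate i true) = base (hSt h T { g2st (i + 1) with u1 := List.replicate i true }) := by
        simp [g2st]
      rw [this]
      exact ⟨_, hbody2 i hi, by simp [g2st], by omega, rfl⟩)
    (m - 1) (base (hSt h T (g2st (m - 1)))) ⟨le_rfl, rfl⟩ (by simp [g2st])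
  obtain ⟨R2, hR2, -, -, rfl⟩ := hL2
  refine (hT2.seq (hU2.seq (hC2.seq hR2))).of_eq ?_ ?_
  · simp [g2st, hu1, hx4, hE0]
  · simp only [blGSeg2Cost, ← hc3]
    omega

/-- Cost of the padding and wrapping. [folklore] -/
def blGPadCost (n k : ℕ) : ℕ :=
  (n * (16 * k + 21) + 3 * k + 7) + 229 * (n + 1) ^ 3 + ((k + 1) * (16 * 2 ^ k + 21) + 5) + (2 ^ k * (2 * (n + 1) ^ 3 + 2) + 1) + 30 * (2 ^ k * (n + 1))

/-- **Padding and wrapping of the `g'` block.** [folklore] -/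
theorem runs_blGPad {N n k n₁ m : ℕ} (hN1 : 1 < N) (hn : (encodeNat N).length + 1 ≤ n) (hk : 1 ≤ k) (hkn : 2 * k + 4 ≤ n) (T : Regs β) (hI : DrvInv (rGH h) N T)
    (u : HSlots) (hbg : u.gw.bg = []) (hn₁ : 1 ≤ n₁) (hkm : n₁ - 1 + m ≤ 2 ^ (k - 1)) {G : List ℕ} (hGl : G.length = n₁ - 1 + m) (hGN : ∀ x ∈ G, x < N)
    (hblk : u.blk = encodeNat k) (hblc1 : u.blc1 = encodeNat n₁) (hblm : u.blm = encodeNat m) {bc : List Bool} (hblc2 : u.blc2 = bc) (hbc : bc.length ≤ n)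
    (hx2 : u.x2 = []) (hx3 : u.x3 = []) (hx4 : u.x4 = []) (hx5 : u.x5 = []) (hx6 : u.x6 = []) (hu1 : u.u1 = []) (hl4 : u.l4 = outRev (G.map encodeNat)) :
    Runs (blGPad h) (base (hSt h T u))
      (base (hSt h T { u with blc2 := [], l4 := [], gw := { u.gw with bg := encBlocks [List.rightpad (2 ^ k) 0 G] } })) (blGPadCost n k) := by
  have hhq : ∀ {i j : HReg}, i ≠ j → h i ≠ h j := fun hij => hq_ne h hij
  obtain ⟨-, -, -, -, -, -, -, -, -, -, hU, -, -, -, -, -, -, -⟩ := hI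
  have hN0 : 0 < N := by omega
  set c := (n + 1) ^ 3 with hc3
  have hc1 : n + 1 ≤ c := by
    rw [hc3]; calc n + 1 = (n + 1) ^ 1 := (pow_one _).symm
      _ ≤ (n + 1) ^ 3 := Nat.pow_le_pow_right (by omega) (by omega)
  have rdU : ∀ u' : HSlots, hSt h T u' (h (.g (.f (.n (.v .U))))) = [] := fun u' => by
    rw [hSt_gv h T u' (by decide) (by decide) (by decide) (by decide) (by decide) (by decide)]; exact hU
  have e1 : encodeNat 1 = [true] := by simpa using encodeNat_two_pow 0
  have hl1n : (encodeNat 1).length ≤ n := by rw [e1]; simp only [List.length_cons, List.length_nil]; omega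
  have hk1 : 2 ^ (k - 1) ≤ 2 ^ k := Nat.pow_le_pow_right (by omega) (by omega)
  have hf1 : 1 ≤ 2 ^ (k - 1) := Nat.one_le_two_pow
  have hf2 : 2 * 2 ^ (k - 1) = 2 ^ k := by rw [← pow_succ']; congr 1; omega
  have h2kk : 2 ^ k ≤ 2 ^ (2 * k) := Nat.pow_le_pow_right (by omega) (by omega)
  have hl2k : ∀ x, x ≤ 2 ^ (2 * k) → (encodeNat x).length ≤ n := fun x hx => length_le_of_le_two_pow_two_mul hx hkn
  have hln₁ : (encodeNat n₁).length ≤ n := hl2k _ (by omega)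
  have hlm : (encodeNat m).length ≤ n := hl2k _ (by omega)
  have hlnm : (encodeNat (n₁ + m)).length ≤ n := hl2k _ (by omega)
  have hlnm1 : (encodeNat (n₁ + m - 1)).length ≤ n := hl2k _ (by omega)
  have hlZ : (encodeNat (2 ^ k - (n₁ + m - 1))).length ≤ n := hl2k _ (by omega)
  have ha1 : 1 ≤ n₁ + m := by omega
  have ha2 : n₁ + m - 1 ≤ 2 ^ k := by omega
  have hlk : (encodeNat k).length ≤ n := (length_encodeNat_le_succ (le_two_pow_self k)).trans (by omega)
  have hl2kk : (encodeNat (2 ^ k)).length ≤ n := by rw [encodeNat_two_pow]; simp; omega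
  set Z := 2 ^ k - (n₁ - 1 + m) with hZ0
  have hZk : Z ≤ 2 ^ k := Nat.sub_le _ _
  have hpad : G ++ List.replicate Z 0 = List.rightpad (2 ^ k) 0 G := by rw [List.rightpad, hGl]
  have hpadN : ∀ x ∈ G ++ List.replicate Z 0, x < N := fun x hx => by
    rcases List.mem_append.1 hx with hx | hx
    · exact hGN x hx
    · rw [List.eq_of_mem_replicate hx]; exact hN0
  have hpadl : (G ++ List.replicate Z 0).length = 2 ^ k := by simp [hGl, hZ0]; omega
  let v1 : HSlots := { u with x4 := encodeNat (2 ^ k) }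
  let v2 : HSlots := { u with x5 := encodeNat Z, blc2 := [] }
  let v3 : HSlots := { v2 with u1 := List.replicate Z true }
  let v4 : HSlots := { v3 with x5 := [] }
  have hP1 : Runs (pow2Into (rGH h) (h .X4) (h .BLK)) (base (hSt h T u)) (base (hSt h T v1)) (n * (16 * k + 21) + 3 * k + 7) := by
    have hne : h .X4 ≠ h .BLK := hhq (by decide)
    have hneU : h .X4 ≠ (rGH h) (.f (.n (.v .U))) := (rGH_ne h .X4 (fun _ e => HReg.noConfusion e) _).symm
    have r1 : hSt h T u (h .BLK) = encodeNat k := by rw [hSt_BLK]; exact hblk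
    have r2 : hSt h T u (h .X4) = [] := by rw [hSt_X4]; exact hx4
    refine (runs_pow2Into (rGH h) hneU hne hlk (hSt h T u) r1 r2 (rdU u)).of_eq ?_ le_rfl
    rw [update_hSt_X4]
  have hP2 : Runs ((NS.ofList [.add (h .X5) (h .BLC1) (h .BLM), .const (h .X2) (encodeNat 1), .sub (h .X6) (h .X5) (h .X2), .clear (h .X5), .clear (h .X2),
      .sub (h .X5) (h .X4) (h .X6), .clear (h .X4), .clear (h .X6), .clear (h .BLC2)] : NS β).com) (base (hSt h T v1)) (base (hSt h T v2)) (226 * c) := by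
    refine NS.runs_of_eq (N := n) _ _ ?_ ?_ (by simp [hc3])
    · simp (config := { decide := true }) only [NS.ofList, NS.ok, NOp.ok, NS.eval, NOp.eval, hSt_X2, hSt_X4, hSt_X5, hSt_X6, hSt_BLC1, hSt_BLC2, hSt_BLM,
        update_hSt_X2, update_hSt_X4, update_hSt_X5, update_hSt_X6, v1, hx2, hx5, hx6, hblc1, hblm, hblc2,
        bitsToNat_encodeNat, List.length_nil, zero_le, and_self, hl1n, hlm, hln₁, hlnm, hlnm1, hl2kk, hbc, ha1, ha2]
    · simp [v1, v2, hx2, hx4, hx5, hx6, hblc1, hblm, hZ0, show n₁ + m - 1 = n₁ - 1 + m by omega]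
  have hP3 : Runs (nToUnary (h .U1) (h .X5)) (base (hSt h T v2)) (base (hSt h T v3)) ((k + 1) * (16 * 2 ^ k + 21) + 5) := by
    refine (runs_nToUnary (h .U1) (h .X5) (hSt h T v2) (by simp [v2, hu1])).of_eq ?_ ?_
    · simp [v2, v3]
    · simp only [hSt_X5, v2, bitsToNat_encodeNat]; exact toUnary_cost_le hZk
  have hP4 : Runs (NS.op (.clear (h .X5)) : NS β).com (base (hSt h T v3)) (base (hSt h T v4)) (3 * c) := by
    refine NS.runs_of_eq (N := n) _ _ ?_ (by simp [v3, v4]) (by simp [hc3])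
    simp only [NS.ok, NOp.ok, hSt_X5, v3, v2]
    have hZl : (encodeNat Z).length ≤ k + 1 := (Brick.length_encodeNat_mono hZk).trans (by rw [encodeNat_two_pow]; simp)
    exact hZl.trans (by omega)
  have hP5 : Runs (blZeros h) (base (hSt h T v4)) (base (hSt h T { v4 with u1 := [], l4 := outRev (G.map encodeNat ++ List.replicate Z []) })) (Z * (2 + 2) + 1) :=
    runs_blZeros h T v4 (G.map encodeNat) Z (by simp [v4, v3, v2, hl4]) (by simp [v4, v3])
  have hmapE : (G ++ List.replicate Z 0).map encodeNat = G.map encodeNat ++ List.replicate Z [] := by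
    simp [List.map_append, List.map_replicate, show encodeNat 0 = [] from rfl]
  have hP6 := runs_blWrap h hn (dst := .g .BG) (by decide) (by decide) (hSt h T { v4 with u1 := [], l4 := outRev (G.map encodeNat ++ List.replicate Z []) })
    (B := G ++ List.replicate Z 0) hpadN (by simp [hmapE]) (by simp [v4, v3, v2, hx3])
  rw [hpadl] at hP6
  refine (hP1.seq (hP2.seq (hP3.seq (hP4.seq (hP5.seq hP6))))).of_eq ?_ ?_
  · simp [v4, v3, v2, hbg, hpad, hx5, hu1]
  · simp only [blGPadCost, ← hc3]
    have h2k0 := Nat.two_pow_pos k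
    have e1' : 2 ^ k * (2 * c + 2) = 2 * (2 ^ k * c) + 2 * 2 ^ k := by ring
    have e2' : 2 ^ k * (2 * n) = 2 * (2 ^ k * n) := by ring
    have e3 : 2 ^ k * (n + 1) = 2 ^ k * n + 2 ^ k := by ring
    have hkc : 2 ^ k ≤ 2 ^ k * c := Nat.le_mul_of_pos_right _ (by omega)
    rw [e1', e2', e3]
    omega

/-- Cost of the `g'` pass. [folklore] -/
def blGPassCost (n k : ℕ) : ℕ := 1567 * (n + 1) ^ 3 + 2 * ((k + 1) * (16 * 2 ^ k + 21) + 5) + (2 ^ k * (2900 * (n + 1) ^ 3 + 2) + 2) + blGPadCost n k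

/-- **The `g'` pass.** [folklore] -/
theorem runs_blGPass {N n k α n₁ m : ℕ} (hN1 : 1 < N) (hn : (encodeNat N).length + 1 ≤ n) (hk : 1 ≤ k) (hkn : 2 * k + 4 ≤ n) (T : Regs β) (hI : DrvInv (rGH h) N T)
    (u : HSlots) (hbg : u.gw.bg = []) (hn₁ : 1 ≤ n₁) (hm : 1 ≤ m) (hkm : n₁ - 1 + m ≤ 2 ^ (k - 1)) (hαN : α < N)
    (hbla : u.bla = encodeNat α) (hblk : u.blk = encodeNat k) (hblpow : u.blpow = encodeNat 2) (hblc1 : u.blc1 = encodeNat n₁) (hblm : u.blm = encodeNat m)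
    (hble : u.ble = []) (hblc2 : u.blc2 = [])
    (hx2 : u.x2 = []) (hx3 : u.x3 = []) (hx4 : u.x4 = []) (hx5 : u.x5 = []) (hx6 : u.x6 = []) (hu1 : u.u1 = []) (hl4 : u.l4 = []) :
    Runs (blGPass h) (base (hSt h T u))
      (base (hSt h T { u with ble := encodeNat (n₁.choose 2 + m.choose 2), gw := { u.gw with bg := encBlocks [List.rightpad (2 ^ k) 0 (NegFFT.chirpG N α (n₁ - 1) m (n₁.choose 2 + m.choose 2))] } }))
      (blGPassCost n k) := by
  have hn₁k : n₁ ≤ 2 ^ (k - 1) := by omega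
  have hmk : m ≤ 2 ^ (k - 1) := by omega
  have hk1 : 2 ^ (k - 1) ≤ 2 ^ k := Nat.pow_le_pow_right (by omega) (by omega)
  set E := n₁.choose 2 + m.choose 2 with hE0
  have h1 := runs_blGSeg1 h hN1 hn hk hkn T hI u hn₁k hmk hαN hbla hblpow hblc1 hblm hble hblc2 hx2 hx4 hx5 hx6 hu1 hl4
  have h2 := runs_blGSeg2 h hN1 hn hk hkn T hI { u with ble := encodeNat E, blc2 := encodeNat n₁, l4 := outRev ((blG1 N α E n₁ n₁).map encodeNat) }
    hn₁k hm hmk hαN (by simp [hbla]) (by simp [hblpow]) (by simp [hblm]) (by simp [hE0]) (by simp) (by simp [hx2]) (by simp [hx4]) (by simp [hx5])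
    (by simp [hx6]) (by simp [hu1]) _ rfl
  have hG : (blG1 N α E n₁ n₁).map encodeNat ++ (blG2 N α E (m - 1)).map encodeNat = (NegFFT.chirpG N α (n₁ - 1) m E).map encodeNat := by
    rw [← List.map_append, blG1_append_blG2 N α E n₁ m hn₁ hm]
  have hGl : (NegFFT.chirpG N α (n₁ - 1) m E).length = n₁ - 1 + m := by simp [NegFFT.chirpG]
  have hGN : ∀ x ∈ NegFFT.chirpG N α (n₁ - 1) m E, x < N := fun x hx => by
    simp only [NegFFT.chirpG, List.mem_map, List.mem_range] at hx
    obtain ⟨j, -, rfl⟩ := hx; exact Nat.mod_lt _ (by omega)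
  have hlm : (encodeNat m).length ≤ n :=
    length_le_of_le_two_pow_two_mul (hmk.trans (hk1.trans (Nat.pow_le_pow_right (by omega) (by omega)))) hkn
  have h3 := runs_blGPad h hN1 hn hk hkn T hI
    { u with ble := encodeNat E, blc2 := encodeNat m, l4 := outRev ((NegFFT.chirpG N α (n₁ - 1) m E).map encodeNat) }
    (by simp [hbg]) hn₁ hkm hGl hGN (by simp [hblk]) (by simp [hblc1]) (by simp [hblm]) (bc := encodeNat m) (by simp) hlm
    (by simp [hx2]) (by simp [hx3]) (by simp [hx4]) (by simp [hx5]) (by simp [hx6]) (by simp [hu1]) (by simp)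
  rw [← hE0] at h1
  rw [hG] at h2
  refine (h1.seq (h2.seq h3)).of_eq ?_ ?_
  · simp [hblc2, hl4]
  · simp only [blGPassCost, blGSeg1Cost, blGSeg2Cost]
    have hloops : n₁ * (2900 * (n + 1) ^ 3 + 2) + 1 + ((m - 1) * (2900 * (n + 1) ^ 3 + 2) + 1) ≤ 2 ^ k * (2900 * (n + 1) ^ 3 + 2) + 2 := by
      have : n₁ + (m - 1) ≤ 2 ^ k := by omega
      have h' := Nat.mul_le_mul_right (2900 * (n + 1) ^ 3 + 2) this
      rw [Nat.add_mul] at h'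
      omega
    omega

/-! #### The multiplication and the extraction of the values -/

/-- The multiplication: `KN := k`, then the breadth-first negacyclic multiplier. [folklore] -/
def blMul : Com (EReg ⊕ β) :=
  ((NS.op (.copy (h .BLK) (h (.g .KN)))) : NS β).com ;; negMulMachine (rGH h)

/-- **The multiplication pass.** [folklore] -/
theorem runs_blMul {N k n : ℕ} (hN1 : 1 < N) (hn : (encodeNat N).length + 1 ≤ n) (hkn4 : k + 4 ≤ n) (T : Regs β) (hI : DrvInv (rGH h) N T)
    (hCI : T (h (.g .CINV)) = encodeNat (NegFFT.inv2N N)) (u : HSlots) (hw : u.gw.Clean) (hsched : u.gw.sched = []) (hhist : u.gw.hist = [])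
    (hkn' : u.gw.kn = []) {Fb Gb : List ℕ} (hFb : NegFFT.BlockOK N (2 ^ k) Fb) (hGb : NegFFT.BlockOK N (2 ^ k) Gb)
    (hbf : u.gw.bf = encBlocks [Fb]) (hbg : u.gw.bg = encBlocks [Gb]) (hblk : u.blk = encodeNat k) :
    Runs (blMul h) (base (hSt h T u))
      (base (hSt h T { u with gw := { u.gw with kn := [], bf := [], bg := [], rr := encBlocks [NegFFT.negMulRec N k Fb Gb] } }))
      (13 * (n + 1) ^ 3 + negMulMachineCost n k 1) := by
  have hhq : ∀ {i j : HReg}, i ≠ j → h i ≠ h j := fun hij => hq_ne h hij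
  have hlk : (encodeNat k).length ≤ n := (length_encodeNat_le_succ (le_two_pow_self k)).trans (by omega)
  have h1 : Runs ((NS.op (.copy (h .BLK) (h (.g .KN)))) : NS β).com (base (hSt h T u))
      (base (hSt h T { u with gw := { u.gw with kn := encodeNat k, bf := encBlocks [Fb], bg := encBlocks [Gb] } })) (13 * (n + 1) ^ 3) := by
    refine NS.runs_of_eq (N := n) _ _ ?_ ?_ (by simp)
    · simp only [NS.ok, NOp.ok, hSt_BLK, hblk, ne_eq, EmbeddingLike.apply_eq_iff_eq]; exact ⟨by decide, hlk⟩
    · simp [hblk, hkn', ← hbf, ← hbg]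
  have hI' : DrvInv (rGH h) N (hBase h T u) := (drvInv_hBase h T u).2 hI
  have h2 := runs_negMulMachine (rGH h) hN1 hn hkn4 (hBase h T u) hI' (by rw [rGH_apply, hBase_g, hCI]) u.gw hw hsched hhist (Fb := [Fb]) (Gb := [Gb])
    (fun b hb => by rw [List.mem_singleton.1 hb]; exact hFb) (fun b hb => by rw [List.mem_singleton.1 hb]; exact hGb) rfl
  rw [gSt_hBase, gSt_hBase] at h2
  exact (h1.seq h2).of_eq (by simp) le_rfl

/-- Dropping to a cons: the next drop and the indexed entry. [folklore] -/
theorem drop_eq_cons_facts (g : List ℕ) : ∀ (d a : ℕ) (l : List ℕ), g.drop d = a :: l → g.drop (d + 1) = l ∧ g.getD d 0 = a := by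
  induction g with
  | nil => intro d a l hh; simp at hh
  | cons x g ih =>
    intro d a l hh
    cases d with
    | zero => simp at hh; obtain ⟨rfl, rfl⟩ := hh; simp
    | succ d => simp only [List.drop_succ_cons] at hh; simpa using ih d a l hh

/-- Skipping one entry of the product. [folklore] -/
def blSkipBody : Com (EReg ⊕ β) :=
  readItemTo (Sum.inr (h .X3)) (Sum.inr (h .X4)) (Sum.inr (h (.g (.f (.n (.v .W)))))) (Sum.inr (h (.g (.f (.n (.v .TT)))))) ;; clear (Sum.inr (h .X4))

/-- Reading the product block off `RR` and skipping its first `n₁ − 1` entries. [folklore] -/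
def blXSkip : Com (EReg ⊕ β) :=
  readItemTo (Sum.inr (h (.g .RR))) (Sum.inr (h .X3)) (Sum.inr (h (.g (.f (.n (.v .W)))))) (Sum.inr (h (.g (.f (.n (.v .TT)))))) ;;
  (((NS.ofList [.const (h .X2) (encodeNat 1), .sub (h .X4) (h .BLC1) (h .X2), .clear (h .X2)] : NS β).com) ;;
  (nToUnary (h .U1) (h .X4) ;; (((NS.op (.clear (h .X4))) : NS β).com ;; countLoop (Sum.inr (h .U1)) (blSkipBody h))))

/-- Cost of the skip. [folklore] -/
def blXSkipCost (n k : ℕ) : ℕ := (11 * (2 ^ k * (2 * n)) + 9) + 81 * (n + 1) ^ 3 + ((k + 1) * (16 * 2 ^ k + 21) + 5) + (2 ^ k * (13 * n + 12) + 1)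

/-- **Reading the product and skipping `n₁ − 1` entries.** [folklore] -/
theorem runs_blXSkip {N n k n₁ : ℕ} (hN1 : 1 < N) (hn : (encodeNat N).length + 1 ≤ n) (hkn : 2 * k + 4 ≤ n) (T : Regs β) (hI : DrvInv (rGH h) N T)
    (u : HSlots) {P : List ℕ} (hP : NegFFT.BlockOK N (2 ^ k) P) (hrr : u.gw.rr = encBlocks [P]) (hn₁ : 1 ≤ n₁) (hn₁k : n₁ ≤ 2 ^ k)
    (hblc1 : u.blc1 = encodeNat n₁) (hx2 : u.x2 = []) (hx3 : u.x3 = []) (hx4 : u.x4 = []) (hu1 : u.u1 = []) :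
    Runs (blXSkip h) (base (hSt h T u)) (base (hSt h T { u with x3 := encVec (P.drop (n₁ - 1)), gw := { u.gw with rr := [] } })) (blXSkipCost n k) := by
  have hhq : ∀ {i j : HReg}, i ≠ j → h i ≠ h j := fun hij => hq_ne h hij
  obtain ⟨-, -, -, -, -, -, hW, hTT, -, -, -, -, -, -, -, -, -, -⟩ := hI
  have hN0 : 0 < N := by omega
  set c := (n + 1) ^ 3 with hc3
  have rdW : ∀ u' : HSlots, hSt h T u' (h (.g (.f (.n (.v .W))))) = [] := fun u' => by
    rw [hSt_gv h T u' (by decide) (by decide) (by decide) (by decide) (by decide) (by decide)]; exact hW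
  have rdTT : ∀ u' : HSlots, hSt h T u' (h (.g (.f (.n (.v .TT))))) = [] := fun u' => by
    rw [hSt_gv h T u' (by decide) (by decide) (by decide) (by decide) (by decide) (by decide)]; exact hTT
  have hlN : (encodeNat N).length ≤ n := by omega
  have e1 : encodeNat 1 = [true] := by simpa using encodeNat_two_pow 0
  have hl1n : (encodeNat 1).length ≤ n := by rw [e1]; simp only [List.length_cons, List.length_nil]; omega
  have h2kk : 2 ^ k ≤ 2 ^ (2 * k) := Nat.pow_le_pow_right (by omega) (by omega)
  have hl2k : ∀ x, x ≤ 2 ^ (2 * k) → (encodeNat x).length ≤ n := fun x hx => length_le_of_le_two_pow_two_mul hx hkn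
  have hln₁ : (encodeNat n₁).length ≤ n := hl2k _ (hn₁k.trans h2kk)
  have hln₁1 : (encodeNat (n₁ - 1)).length ≤ n := hl2k _ ((Nat.sub_le _ _).trans (hn₁k.trans h2kk))
  have hlP : (encVec P).length ≤ 2 ^ k * (2 * n) := by
    have := length_encVec_le_of_lt hP.2 hn; rwa [hP.1] at this
  -- read the block
  let u1 : HSlots := { u with x3 := encVec P, gw := { u.gw with rr := [] } }
  have h1 : Runs (readItemTo (Sum.inr (h (.g .RR))) (Sum.inr (h .X3)) (Sum.inr (h (.g (.f (.n (.v .W)))))) (Sum.inr (h (.g (.f (.n (.v .TT)))))))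
      (base (hSt h T u)) (base (hSt h T u1)) (11 * (2 ^ k * (2 * n)) + 9) := by
    refine (runs_readItemTo (by simp [hhq]) (by simp [hhq]) (by simp [hhq]) (by simp [hhq]) (by simp [hhq]) (encVec P) []
      (base (hSt h T u)) (by simp [hrr, encBlocks, encList, boolPair, dbl]) (by simp [rdW]) (by simp [rdTT])).of_eq ?_ (by omega)
    simp [u1, hx3]
  let u2 : HSlots := { u1 with x4 := encodeNat (n₁ - 1) }
  have h2 : Runs ((NS.ofList [.const (h .X2) (encodeNat 1), .sub (h .X4) (h .BLC1) (h .X2), .clear (h .X2)] : NS β).com) (base (hSt h T u1)) (base (hSt h T u2)) (78 * c) := by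
    refine NS.runs_of_eq (N := n) _ _ ?_ ?_ (by simp [hc3])
    · simp (config := { decide := true }) only [NS.ofList, NS.ok, NOp.ok, NS.eval, NOp.eval, hSt_X2, hSt_X4, hSt_BLC1, update_hSt_X2, update_hSt_X4,
        u1, hx2, hx4, hblc1, bitsToNat_encodeNat, List.length_nil, zero_le, and_self, hl1n, hln₁, hn₁]
    · simp [u1, u2, hx2, hx4, hblc1]
  let u3 : HSlots := { u2 with u1 := List.replicate (n₁ - 1) true }
  have h3 : Runs (nToUnary (h .U1) (h .X4)) (base (hSt h T u2)) (base (hSt h T u3)) ((k + 1) * (16 * 2 ^ k + 21) + 5) := by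
    refine (runs_nToUnary (h .U1) (h .X4) (hSt h T u2) (by simp [u2, u1, hu1])).of_eq ?_ ?_
    · simp [u2, u3]
    · simp only [hSt_X4, u2, bitsToNat_encodeNat]; exact toUnary_cost_le ((Nat.sub_le _ _).trans hn₁k)
  let sst : ℕ → HSlots := fun i => { u1 with u1 := List.replicate i true, x3 := encVec (P.drop (n₁ - 1 - i)) }
  have h4 : Runs (NS.op (.clear (h .X4)) : NS β).com (base (hSt h T u3)) (base (hSt h T (sst (n₁ - 1)))) (3 * c) := by
    refine NS.runs_of_eq (N := n) _ _ (by simp only [NS.ok, NOp.ok, hSt_X4, u3, u2]; exact hln₁1) ?_ (by simp [hc3])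
    simp [u3, u2, u1, sst, hx4]
  have hbody : ∀ i, i + 1 ≤ n₁ - 1 → Runs (blSkipBody h) (base (hSt h T { sst (i + 1) with u1 := List.replicate i true })) (base (hSt h T (sst i))) (13 * n + 10) := by
    intro i hi
    have hlt : n₁ - 1 - (i + 1) < P.length := by rw [hP.1]; omega
    obtain ⟨a, l, hal⟩ : ∃ a l, P.drop (n₁ - 1 - (i + 1)) = a :: l := by
      cases hd : P.drop (n₁ - 1 - (i + 1)) with
      | nil => exact absurd (List.drop_eq_nil_iff.1 hd) (by omega)
      | cons a l => exact ⟨a, l, rfl⟩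
    obtain ⟨hdrop', -⟩ := drop_eq_cons_facts P _ a l hal
    have heq : n₁ - 1 - (i + 1) + 1 = n₁ - 1 - i := by omega
    rw [heq] at hdrop'
    have ha : a < N := hP.2 a (List.mem_of_mem_drop (l := P) (i := n₁ - 1 - (i + 1)) (by rw [hal]; simp))
    have hla : (encodeNat a).length ≤ n := (Brick.length_encodeNat_mono ha.le).trans hlN
    have g1 : Runs (readItemTo (Sum.inr (h .X3)) (Sum.inr (h .X4)) (Sum.inr (h (.g (.f (.n (.v .W)))))) (Sum.inr (h (.g (.f (.n (.v .TT)))))))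
        (base (hSt h T { sst (i + 1) with u1 := List.replicate i true })) (base (hSt h T { sst i with x4 := encodeNat a })) (11 * n + 9) := by
      refine (runs_readItemTo (by simp [hhq]) (by simp [hhq]) (by simp [hhq]) (by simp [hhq]) (by simp [hhq]) (encodeNat a) (encVec l)
        (base (hSt h T { sst (i + 1) with u1 := List.replicate i true })) (by simp [sst, hal, encVec_cons]) (by simp [rdW]) (by simp [rdTT])).of_eq ?_ (by omega)
      simp [sst, u1, hx4, hdrop']
    have g2 : Runs (clear (Sum.inr (h .X4))) (base (hSt h T { sst i with x4 := encodeNat a })) (base (hSt h T (sst i))) (2 * n + 1) := by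
      refine (runs_clear (Sum.inr (h .X4)) (base (hSt h T { sst i with x4 := encodeNat a }))).of_eq (by simp [sst, u1, hx4]) ?_
      change 2 * (base (hSt h T { sst i with x4 := encodeNat a }) (Sum.inr (h .X4))).length + 1 ≤ _
      simp only [nst_inr, hSt_X4]; omega
    exact (g1.seq g2).of_eq rfl (by omega)
  have hL := runs_countLoop (U := (Sum.inr (h .U1) : EReg ⊕ β)) (body := blSkipBody h) (fun i R => i ≤ n₁ - 1 ∧ R = base (hSt h T (sst i))) (13 * n + 10)
    (by
      rintro i R ⟨hi, rfl⟩ -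
      have : Function.update (base (hSt h T (sst (i + 1)))) (Sum.inr (h .U1)) (List.replicate i true) = base (hSt h T { sst (i + 1) with u1 := List.replicate i true }) := by
        simp [sst]
      rw [this]
      exact ⟨_, hbody i hi, by simp [sst], by omega, rfl⟩)
    (n₁ - 1) (base (hSt h T (sst (n₁ - 1)))) ⟨le_rfl, rfl⟩ (by simp [sst])
  obtain ⟨R', hR, -, -, rfl⟩ := hL
  refine (h1.seq (h2.seq (h3.seq (h4.seq hR)))).of_eq ?_ ?_
  · simp [sst, u1, hu1]
  · simp only [blXSkipCost, ← hc3]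
    have h13 : (n₁ - 1) * (13 * n + 10 + 2) ≤ 2 ^ k * (13 * n + 12) := Nat.mul_le_mul (by omega) (by omega)
    omega

/-- The machine's value list: `w_i = (α^{C(i,2)} mod N) · P_{n₀+i} mod N`. [folklore] -/
def blXList (N α n₀ : ℕ) (P : List ℕ) (d : ℕ) : List ℕ := (List.range d).map fun i => α ^ ((i * i - i) / 2) % N * P.getD (n₀ + i) 0 % N

/-- `blXList_succ`. [folklore] -/
theorem blXList_succ (N α n₀ : ℕ) (P : List ℕ) (d : ℕ) :
    blXList N α n₀ P (d + 1) = blXList N α n₀ P d ++ [α ^ ((d * d - d) / 2) % N * P.getD (n₀ + d) 0 % N] := by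
  simp [blXList, List.range_succ]

/-- One value: read `P_{n₀+i}`, `C(i,2)`, `powMod`, `mulMod`, counter, emit. [folklore] -/
def blXBody : Com (EReg ⊕ β) :=
  readItemTo (Sum.inr (h .X3)) (Sum.inr (h .X4)) (Sum.inr (h (.g (.f (.n (.v .W)))))) (Sum.inr (h (.g (.f (.n (.v .TT)))))) ;;
  (((NS.ofList [.mul (h .X5) (h .BLC2) (h .BLC2), .sub (h .X6) (h .X5) (h .BLC2), .clear (h .X5), .divMod (h .X5) (h .X2) (h .X6) (h .BLPOW),
      .clear (h .X2), .clear (h .X6), .powMod (h .X6) (h .BLA) (h .X5) (h (.g (.f (.n (.v .MD))))), .clear (h .X5),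
      .mulMod (h .X6) (h .X4) (h (.g (.f (.n (.v .MD))))), .clear (h .X4), .succ (h .X4) (h .BLC2), .clear (h .BLC2), .move (h .X4) (h .BLC2)] : NS β).com) ;;
  emit (Sum.inr (h .X6)) (Sum.inr (h .L4)))

/-- The values: `m` of them, poured onto `BLOUT`, then the clean-up. [folklore] -/
def blXVals : Com (EReg ⊕ β) :=
  nToUnary (h .U1) (h .BLM) ;;
  (countLoop (Sum.inr (h .U1)) (blXBody h) ;;
  (pour (Sum.inr (h .L4)) (Sum.inr (h .BLOUT)) ;;
  (clear (Sum.inr (h .X3)) ;;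
  ((NS.ofList [.clear (h .BLC2), .clear (h .BLE), .clear (h .BLC1)] : NS β).com))))

/-- Cost of the value extraction. [folklore] -/
def blXValsCost (n k : ℕ) : ℕ := ((k + 1) * (16 * 2 ^ k + 21) + 5) + (2 ^ k * (3800 * (n + 1) ^ 3 + 2) + 1) + 7 * (2 ^ k * (2 * n)) + 2 + 9 * (n + 1) ^ 3

/-- **The value extraction.** [folklore] -/
theorem runs_blXVals {N n k α n₀ m : ℕ} (hN1 : 1 < N) (hn : (encodeNat N).length + 1 ≤ n) (hk : 1 ≤ k) (hkn : 2 * k + 4 ≤ n) (T : Regs β) (hI : DrvInv (rGH h) N T)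
    (u : HSlots) {P : List ℕ} (hP : NegFFT.BlockOK N (2 ^ k) P) (hm : m ≤ 2 ^ (k - 1)) (hn₀m : n₀ + m ≤ 2 ^ k) (hαN : α < N)
    (hbla : u.bla = encodeNat α) (hblpow : u.blpow = encodeNat 2) (hblm : u.blm = encodeNat m) {E n₁ : ℕ} (hble : u.ble = encodeNat E) (hE : E ≤ 2 ^ (2 * k))
    (hblc1 : u.blc1 = encodeNat n₁) (hn₁ : n₁ ≤ 2 ^ k) (hblc2 : u.blc2 = [])
    (hx2 : u.x2 = []) (hx3 : u.x3 = encVec (P.drop n₀)) (hx4 : u.x4 = []) (hx5 : u.x5 = []) (hx6 : u.x6 = []) (hu1 : u.u1 = []) (hl4 : u.l4 = []) (hblout : u.blout = []) :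
    Runs (blXVals h) (base (hSt h T u))
      (base (hSt h T { u with x3 := [], ble := [], blc1 := [], blout := encVec (blXList N α n₀ P m) })) (blXValsCost n k) := by
  have hhq : ∀ {i j : HReg}, i ≠ j → h i ≠ h j := fun hij => hq_ne h hij
  obtain ⟨hMD, -, -, -, -, -, hW, hTT, -, -, -, -, -, -, -, -, -, -⟩ := hI
  have hN0 : 0 < N := by omega
  set c := (n + 1) ^ 3 with hc3
  have hc1 : n + 1 ≤ c := by
    rw [hc3]; calc n + 1 = (n + 1) ^ 1 := (pow_one _).symm
      _ ≤ (n + 1) ^ 3 := Nat.pow_le_pow_right (by omega) (by omega)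
  have rdMD : ∀ u' : HSlots, hSt h T u' (h (.g (.f (.n (.v .MD))))) = encodeNat N := fun u' => by
    rw [hSt_gv h T u' (by decide) (by decide) (by decide) (by decide) (by decide) (by decide)]; exact hMD
  have rdW : ∀ u' : HSlots, hSt h T u' (h (.g (.f (.n (.v .W))))) = [] := fun u' => by
    rw [hSt_gv h T u' (by decide) (by decide) (by decide) (by decide) (by decide) (by decide)]; exact hW
  have rdTT : ∀ u' : HSlots, hSt h T u' (h (.g (.f (.n (.v .TT))))) = [] := fun u' => by
    rw [hSt_gv h T u' (by decide) (by decide) (by decide) (by decide) (by decide) (by decide)]; exact hTT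
  have hlN : (encodeNat N).length ≤ n := by omega
  have hlα : (encodeNat α).length ≤ n := (Brick.length_encodeNat_mono hαN.le).trans hlN
  have e2 : encodeNat 2 = [false, true] := by simpa using encodeNat_two_pow 1
  have hl2' : (encodeNat 2).length ≤ n := by rw [e2]; simp only [List.length_cons, List.length_nil]; omega
  have hk1 : 2 ^ (k - 1) ≤ 2 ^ k := Nat.pow_le_pow_right (by omega) (by omega)
  have hkk : 2 ^ (k - 1) * 2 ^ (k - 1) ≤ 2 ^ (2 * k) := by rw [← pow_add]; exact Nat.pow_le_pow_right (by omega) (by omega)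
  have h2kk : 2 ^ k ≤ 2 ^ (2 * k) := Nat.pow_le_pow_right (by omega) (by omega)
  have hl2k : ∀ x, x ≤ 2 ^ (2 * k) → (encodeNat x).length ≤ n := fun x hx => length_le_of_le_two_pow_two_mul hx hkn
  have hsub : ∀ x : ℕ, x ≤ x * x := fun x => by nlinarith
  have hsq : ∀ x : ℕ, x ≤ 2 ^ (k - 1) → x * x ≤ 2 ^ (2 * k) := fun x hx => (Nat.mul_le_mul hx hx).trans hkk
  have hlm : (encodeNat m).length ≤ n := hl2k _ (hm.trans (hk1.trans h2kk))
  have hlE : (encodeNat E).length ≤ n := hl2k _ hE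
  have hln₁ : (encodeNat n₁).length ≤ n := hl2k _ (hn₁.trans h2kk)
  have hmk' : m ≤ 2 ^ k := hm.trans hk1
  -- the loop states
  let xst : ℕ → HSlots := fun i =>
    { u with u1 := List.replicate i true, x3 := encVec (P.drop (n₀ + (m - i))), blc2 := encodeNat (m - i), l4 := outRev ((blXList N α n₀ P (m - i)).map encodeNat) }
  have h0 : Runs (nToUnary (h .U1) (h .BLM)) (base (hSt h T u)) (base (hSt h T (xst m))) ((k + 1) * (16 * 2 ^ k + 21) + 5) := by
    refine (runs_nToUnary (h .U1) (h .BLM) (hSt h T u) (by simp [hu1])).of_eq ?_ ?_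
    · simp [xst, hblm, hx3, hblc2, hl4, blXList, show encodeNat 0 = [] from rfl]
    · simp only [hSt_BLM, hblm, bitsToNat_encodeNat]; exact toUnary_cost_le hmk'
  have hbody : ∀ i, i + 1 ≤ m → Runs (blXBody h) (base (hSt h T { xst (i + 1) with u1 := List.replicate i true })) (base (hSt h T (xst i))) (3800 * c) := by
    intro i hi
    set d := m - (i + 1) with hd0
    have hd1 : m - i = d + 1 := by omega
    have hlt : n₀ + d < P.length := by rw [hP.1]; omega
    obtain ⟨a, l, hal⟩ : ∃ a l, P.drop (n₀ + d) = a :: l := by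
      cases hd : P.drop (n₀ + d) with
      | nil => exact absurd (List.drop_eq_nil_iff.1 hd) (by omega)
      | cons a l => exact ⟨a, l, rfl⟩
    obtain ⟨hdrop', hgetD⟩ := drop_eq_cons_facts P _ a l hal
    have ha : a < N := hP.2 a (List.mem_of_mem_drop (l := P) (i := n₀ + d) (by rw [hal]; simp))
    have hla : (encodeNat a).length ≤ n := (Brick.length_encodeNat_mono ha.le).trans hlN
    have hdk : d ≤ 2 ^ (k - 1) := by omega
    have hdd := hsq d hdk
    have hld : (encodeNat d).length ≤ n := hl2k _ (hdk.trans (hk1.trans h2kk))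
    have hld1 : (encodeNat (d + 1)).length ≤ n := hl2k _ (by omega)
    have hl3 : (encodeNat (d * d)).length ≤ n := hl2k _ hdd
    have hl4' : (encodeNat (d * d - d)).length ≤ n := hl2k _ ((Nat.sub_le _ _).trans hdd)
    have hl5 : (encodeNat ((d * d - d) / 2)).length ≤ n := hl2k _ ((Nat.div_le_self _ _).trans ((Nat.sub_le _ _).trans hdd))
    have hl6 : (encodeNat ((d * d - d) % 2)).length ≤ n :=
      hl2k _ (by have := Nat.mod_lt (d * d - d) (show 0 < 2 by omega); have := Nat.one_le_two_pow (n := 2 * k); omega)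
    have hl7 : (encodeNat (α ^ ((d * d - d) / 2) % N)).length ≤ n := (Brick.length_encodeNat_mono (Nat.mod_lt _ hN0).le).trans hlN
    have hl8 : (encodeNat (α ^ ((d * d - d) / 2) % N * a % N)).length ≤ n := (Brick.length_encodeNat_mono (Nat.mod_lt _ hN0).le).trans hlN
    let ua : HSlots := { xst (i + 1) with u1 := List.replicate i true }
    let ub : HSlots := { ua with x3 := encVec l, x4 := encodeNat a }
    let uc : HSlots := { ub with x4 := [], blc2 := encodeNat (d + 1), x6 := encodeNat (α ^ ((d * d - d) / 2) % N * a % N) }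
    have g1 : Runs (readItemTo (Sum.inr (h .X3)) (Sum.inr (h .X4)) (Sum.inr (h (.g (.f (.n (.v .W)))))) (Sum.inr (h (.g (.f (.n (.v .TT)))))))
        (base (hSt h T ua)) (base (hSt h T ub)) (11 * n + 9) := by
      refine (runs_readItemTo (by simp [hhq]) (by simp [hhq]) (by simp [hhq]) (by simp [hhq]) (by simp [hhq]) (encodeNat a) (encVec l)
        (base (hSt h T ua)) (by simp [ua, xst, ← hd0, hal, encVec_cons]) (by simp [rdW]) (by simp [rdTT])).of_eq ?_ (by omega)
      simp [ua, ub, xst, hx4]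
    have g2 : Runs ((NS.ofList [.mul (h .X5) (h .BLC2) (h .BLC2), .sub (h .X6) (h .X5) (h .BLC2), .clear (h .X5), .divMod (h .X5) (h .X2) (h .X6) (h .BLPOW),
        .clear (h .X2), .clear (h .X6), .powMod (h .X6) (h .BLA) (h .X5) (h (.g (.f (.n (.v .MD))))), .clear (h .X5),
        .mulMod (h .X6) (h .X4) (h (.g (.f (.n (.v .MD))))), .clear (h .X4), .succ (h .X4) (h .BLC2), .clear (h .BLC2), .move (h .X4) (h .BLC2)] : NS β).com)
        (base (hSt h T ub)) (base (hSt h T uc)) (3629 * c) := by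
      refine NS.runs_of_eq (N := n) _ _ ?_ ?_ (by simp [hc3])
      · simp (config := { decide := true }) only [NS.ofList, NS.ok, NOp.ok, NS.eval, NOp.eval, hSt_X2, hSt_X4, hSt_X5, hSt_X6, hSt_BLC2,
          hSt_BLPOW, hSt_BLA, update_hSt_X2, update_hSt_X4, update_hSt_X5, update_hSt_X6, update_hSt_BLC2, ub, ua, xst, ← hd0, hx2, hx5, hx6,
          hbla, hblpow, rdMD, bitsToNat_encodeNat, ne_eq, EmbeddingLike.apply_eq_iff_eq, List.length_nil, zero_le, and_self,
          hld, hld1, hl3, hl4', hl5, hl6, hl7, hla, hlα, hlN, hl2', hsub, hN1, hN0, not_false_eq_true, Nat.ofNat_pos]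
      · simp [ub, uc, ua, xst, ← hd0, hx2, hx5, hx6, hbla, hblpow, rdMD]
    have g3 : Runs (emit (Sum.inr (h .X6)) (Sum.inr (h .L4))) (base (hSt h T uc)) (base (hSt h T (xst i))) (4 * n + 3) := by
      refine (runs_emit (h := (Sum.inr (h .X6) : EReg ⊕ β)) (o := Sum.inr (h .L4)) (by simp [hhq]) (base (hSt h T uc))).of_eq ?_ ?_
      · have hn0d : n₀ + (d + 1) = n₀ + d + 1 := by omega
        have hgetD' : P[n₀ + d]?.getD 0 = a := by rw [← List.getD_eq_getElem?_getD]; exact hgetD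
        simp [uc, ub, ua, xst, ← hd0, hd1, hx4, hx6, blXList_succ, hgetD', hdrop', hn0d, List.map_append, outRev_append]
      · simp only [nst_inr, hSt_X6, uc]; omega
    exact (g1.seq (g2.seq g3)).of_eq rfl (by omega)
  have hL := runs_countLoop (U := (Sum.inr (h .U1) : EReg ⊕ β)) (body := blXBody h) (fun i R => i ≤ m ∧ R = base (hSt h T (xst i))) (3800 * c)
    (by
      rintro i R ⟨hi, rfl⟩ -
      have : Function.update (base (hSt h T (xst (i + 1)))) (Sum.inr (h .U1)) (List.replicate i true) = base (hSt h T { xst (i + 1) with u1 := List.replicate i true }) := by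
        simp [xst]
      rw [this]
      exact ⟨_, hbody i hi, by simp [xst], by omega, rfl⟩)
    m (base (hSt h T (xst m))) ⟨le_rfl, rfl⟩ (by simp [xst])
  obtain ⟨R', hR, -, -, rfl⟩ := hL
  -- pour, clear, clears
  set V := blXList N α n₀ P m with hV0
  have hVN : ∀ x ∈ V, x < N := fun x hx => by
    simp only [hV0, blXList, List.mem_map, List.mem_range] at hx
    obtain ⟨j, -, rfl⟩ := hx; exact Nat.mod_lt _ hN0
  have hVl : V.length = m := by simp [hV0, blXList]
  have hlV : (encVec V).length ≤ 2 ^ k * (2 * n) := by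
    have := length_encVec_le_of_lt hVN hn; rw [hVl] at this; exact this.trans (Nat.mul_le_mul_right _ hmk')
  have hrev : (outRev (V.map encodeNat)).reverse = encVec V := by rw [reverse_outRev]; rfl
  have hlo : (outRev (V.map encodeNat)).length = (encVec V).length := by rw [← hrev, List.length_reverse]
  have hrestN : ∀ x ∈ P.drop (n₀ + m), x < N := fun x hx => hP.2 x (List.mem_of_mem_drop hx)
  have hlrest : (encVec (P.drop (n₀ + m))).length ≤ 2 ^ k * (2 * n) :=
    (length_encVec_le_of_lt hrestN hn).trans (Nat.mul_le_mul_right _ (by rw [List.length_drop, hP.1]; omega))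
  let w1 : HSlots := { xst 0 with l4 := [], blout := encVec V }
  let w2 : HSlots := { w1 with x3 := [] }
  have p1 : Runs (pour (Sum.inr (h .L4)) (Sum.inr (h .BLOUT))) (base (hSt h T (xst 0))) (base (hSt h T w1)) (3 * (2 ^ k * (2 * n)) + 1) := by
    refine (runs_opour (a := h .L4) (b := h .BLOUT) (hhq (by decide)) (hSt h T (xst 0))).of_eq ?_ ?_
    · simp [xst, w1, hrev, hblout, ← hV0]
    · simp only [hSt_L4, xst, Nat.sub_zero, ← hV0, hlo]; omega
  have p2 : Runs (clear (Sum.inr (h .X3))) (base (hSt h T w1)) (base (hSt h T w2)) (2 * (2 ^ k * (2 * n)) + 1) := by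
    refine (runs_clear (Sum.inr (h .X3)) (base (hSt h T w1))).of_eq (by simp [w1, w2]) ?_
    simp only [nst_inr, hSt_X3, w1, xst, Nat.sub_zero]; omega
  have p3 : Runs ((NS.ofList [.clear (h .BLC2), .clear (h .BLE), .clear (h .BLC1)] : NS β).com) (base (hSt h T w2))
      (base (hSt h T { u with x3 := [], ble := [], blc1 := [], blout := encVec V })) (9 * c) := by
    refine NS.runs_of_eq (N := n) _ _ ?_ ?_ (by simp [hc3])
    · simp only [NS.ofList, NS.ok, NOp.ok, NS.eval, NOp.eval, hSt_BLC2, hSt_BLE, hSt_BLC1, update_hSt_BLC2, update_hSt_BLE, w2, w1, xst, hble, hblc1,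
        Nat.sub_zero, and_true]
      exact ⟨hlm, hlE, hln₁⟩
    · simp [w2, w1, xst, hu1, hblc2, hl4]
  refine (h0.seq (hR.seq (p1.seq (p2.seq p3)))).of_eq rfl ?_
  simp only [blXValsCost, ← hc3]
  have hloop : m * (3800 * c + 2) ≤ 2 ^ k * (3800 * c + 2) := Nat.mul_le_mul_right _ hmk'
  omega

/-! #### The whole evaluation -/

/-- **Bluestein's evaluation machine**: `f'` pass, `g'` pass, multiplication, skip, values. [folklore] -/
def bluestein : Com (EReg ⊕ β) :=
  blFPass h ;; (blGPass h ;; (blMul h ;; (blXSkip h ;; blXVals h)))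

/-- Cost of Bluestein's evaluation on `V` coefficients with transform length `2^k`. [folklore] -/
def bluesteinCost (n k V : ℕ) : ℕ :=
  blFPassCost n k V + (blGPassCost n k + ((13 * (n + 1) ^ 3 + negMulMachineCost n k 1) + (blXSkipCost n k + blXValsCost n k)))

/-- The machine's values are `bluesteinValues`. [folklore] -/
theorem blXList_eq_bluesteinValues (N α m k : ℕ) {f : List ℕ} (hf : f ≠ []) :
    blXList N α (f.length - 1)
      (NegFFT.negMulRec N k (List.rightpad (2 ^ k) 0 (NegFFT.chirpF N α f))
        (List.rightpad (2 ^ k) 0 (NegFFT.chirpG N α (f.length - 1) m (f.length.choose 2 + m.choose 2)))) m =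
      NegFFT.bluesteinValues N α m k f := by
  have hfl : f.length - 1 + 1 = f.length := Nat.sub_add_cancel (List.length_pos_iff.2 hf)
  simp only [blXList, NegFFT.bluesteinValues, hfl]
  refine List.map_congr_left fun i _ => ?_
  rw [Nat.mod_mul_mod, ← choose_two_eq_sq_sub, Nat.add_comm (f.length - 1) i]

/-- **Bluestein's evaluation on the machine**: from the coefficient list `f` on `BLF` (and `α`, `m`,
`k` on their registers) to `bluesteinValues N α m k f` on `BLOUT`. [folklore] -/
theorem runs_bluestein {N n k α m : ℕ} (hNodd : Odd N) (hN1 : 1 < N) (hn : (encodeNat N).length + 1 ≤ n) (hk : 1 ≤ k) (hkn : 2 * k + 4 ≤ n)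
    (T : Regs β) (hI : DrvInv (rGH h) N T) (hCI : T (h (.g .CINV)) = encodeNat (NegFFT.inv2N N))
    (u : HSlots) (hw : u.gw.Clean) (hsched : u.gw.sched = []) (hhist : u.gw.hist = []) (hkn' : u.gw.kn = []) (hbf : u.gw.bf = []) (hbg : u.gw.bg = [])
    {f : List ℕ} (hf : f ≠ []) (hfN : ∀ v ∈ f, v < N) (hm : 1 ≤ m) (hkm : f.length - 1 + m ≤ 2 ^ (k - 1)) (hαN : α < N)
    (hbla : u.bla = encodeNat α) (hblm : u.blm = encodeNat m) (hblk : u.blk = encodeNat k) (hblpow : u.blpow = encodeNat 2)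
    (hble : u.ble = []) (hblc1 : u.blc1 = []) (hblc2 : u.blc2 = []) (hblout : u.blout = [])
    (hx2 : u.x2 = []) (hx3 : u.x3 = []) (hx4 : u.x4 = []) (hx5 : u.x5 = []) (hx6 : u.x6 = []) (hfl1 : u.fl1 = []) (hu1 : u.u1 = []) (hl4 : u.l4 = []) :
    Runs (bluestein h) (base (hSt h T { u with blf := encVec f }))
      (base (hSt h T { u with blf := [], blout := encVec (NegFFT.bluesteinValues N α m k f) })) (bluesteinCost n k f.length) := by
  obtain ⟨hkd, har, hlvn, hlvu, hmreg, htreg, hhn0, hm20, hm40, hlen0, htw2, htws, htw3, htmph, hout, htwout, hcc, hw0, hrr, hfz⟩ := id hw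
  set n₁ := f.length with hn₁0
  have hn₁ : 1 ≤ n₁ := List.length_pos_iff.2 hf
  have hn₁k : n₁ ≤ 2 ^ (k - 1) := by omega
  have hmk : m ≤ 2 ^ (k - 1) := by omega
  have hk1 : 2 ^ (k - 1) ≤ 2 ^ k := Nat.pow_le_pow_right (by omega) (by omega)
  set E := n₁.choose 2 + m.choose 2 with hE0
  set Fp := List.rightpad (2 ^ k) 0 (NegFFT.chirpF N α f) with hFp
  set Gp := List.rightpad (2 ^ k) 0 (NegFFT.chirpG N α (n₁ - 1) m E) with hGp
  have hFpOK : NegFFT.BlockOK N (2 ^ k) Fp := by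
    refine ⟨?_, fun x hx => ?_⟩
    · rw [hFp, NegFFT.length_rightpad_of_le]; simp [NegFFT.chirpF]; omega
    · rw [hFp, List.rightpad] at hx
      rcases List.mem_append.1 hx with hx | hx
      · simp only [NegFFT.chirpF, List.mem_map, List.mem_range] at hx; obtain ⟨j, -, rfl⟩ := hx; exact Nat.mod_lt _ (by omega)
      · rw [List.eq_of_mem_replicate hx]; omega
  have hGpOK : NegFFT.BlockOK N (2 ^ k) Gp := by
    refine ⟨?_, fun x hx => ?_⟩
    · rw [hGp, NegFFT.length_rightpad_of_le]; simp [NegFFT.chirpG]; omega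
    · rw [hGp, List.rightpad] at hx
      rcases List.mem_append.1 hx with hx | hx
      · simp only [NegFFT.chirpG, List.mem_map, List.mem_range] at hx; obtain ⟨j, -, rfl⟩ := hx; exact Nat.mod_lt _ (by omega)
      · rw [List.eq_of_mem_replicate hx]; omega
  set P := NegFFT.negMulRec N k Fp Gp with hP0
  have hPOK : NegFFT.BlockOK N (2 ^ k) P := (NegFFT.negMulRec_spec hNodd hN1 k hFpOK hGpOK).1
  -- the five passes
  let s1 : HSlots := { u with blf := [], blc1 := encodeNat n₁, gw := { u.gw with bf := encBlocks [Fp] } }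
  have h1 : Runs (blFPass h) (base (hSt h T { u with blf := encVec f })) (base (hSt h T s1)) (blFPassCost n k n₁) :=
    runs_blFPass h hN1 hn hkn T hI u hbf hfN (by omega) hαN hbla hblk hblpow hblc1 hx2 hx3 hx4 hx5 hx6 hfl1 hu1 hl4
  let s2 : HSlots := { s1 with ble := encodeNat E, gw := { s1.gw with bg := encBlocks [Gp] } }
  have h2 : Runs (blGPass h) (base (hSt h T s1)) (base (hSt h T s2)) (blGPassCost n k) :=
    runs_blGPass h hN1 hn hk hkn T hI s1 (by simp [s1, hbg]) hn₁ hm hkm hαN (by simp [s1, hbla]) (by simp [s1, hblk]) (by simp [s1, hblpow]) (by simp [s1])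
      (by simp [s1, hblm]) (by simp [s1, hble]) (by simp [s1, hblc2]) (by simp [s1, hx2]) (by simp [s1, hx3]) (by simp [s1, hx4]) (by simp [s1, hx5])
      (by simp [s1, hx6]) (by simp [s1, hu1]) (by simp [s1, hl4])
  have hclean2 : s2.gw.Clean := by
    unfold GSlots.Clean at hw ⊢; simpa [s2, s1] using hw
  let s3 : HSlots := { s2 with gw := { s2.gw with kn := [], bf := [], bg := [], rr := encBlocks [P] } }
  have h3 : Runs (blMul h) (base (hSt h T s2)) (base (hSt h T s3)) (13 * (n + 1) ^ 3 + negMulMachineCost n k 1) :=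
    runs_blMul h hN1 hn (by omega) T hI hCI s2 hclean2 (by simp [s2, s1, hsched]) (by simp [s2, s1, hhist]) (by simp [s2, s1, hkn']) hFpOK hGpOK
      (by simp [s2, s1]) (by simp [s2]) (by simp [s2, s1, hblk])
  let s4 : HSlots := { s3 with x3 := encVec (P.drop (n₁ - 1)), gw := { s3.gw with rr := [] } }
  have h4 : Runs (blXSkip h) (base (hSt h T s3)) (base (hSt h T s4)) (blXSkipCost n k) :=
    runs_blXSkip h hN1 hn hkn T hI s3 hPOK (by simp [s3]) hn₁ (hn₁k.trans hk1) (by simp [s3, s2, s1]) (by simp [s3, s2, s1, hx2]) (by simp [s3, s2, s1, hx3])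
      (by simp [s3, s2, s1, hx4]) (by simp [s3, s2, s1, hu1])
  have h5 : Runs (blXVals h) (base (hSt h T s4)) (base (hSt h T { s4 with x3 := [], ble := [], blc1 := [], blout := encVec (blXList N α (n₁ - 1) P m) }))
      (blXValsCost n k) :=
    runs_blXVals h hN1 hn hk hkn T hI s4 hPOK hmk (by omega) hαN (by simp [s4, s3, s2, s1, hbla]) (by simp [s4, s3, s2, s1, hblpow])
      (by simp [s4, s3, s2, s1, hblm]) (by simp [s4, s3, s2, hE0]) (blE_le hk hn₁k hmk) (by simp [s4, s3, s2, s1]) (hn₁k.trans hk1) (by simp [s4, s3, s2, s1, hblc2])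
      (by simp [s4, s3, s2, s1, hx2]) (by simp [s4]) (by simp [s4, s3, s2, s1, hx4]) (by simp [s4, s3, s2, s1, hx5]) (by simp [s4, s3, s2, s1, hx6])
      (by simp [s4, s3, s2, s1, hu1]) (by simp [s4, s3, s2, s1, hl4]) (by simp [s4, s3, s2, s1, hblout])
  have hvals : blXList N α (n₁ - 1) P m = NegFFT.bluesteinValues N α m k f := by
    rw [hP0, hFp, hGp, hE0, hn₁0]; exact blXList_eq_bluesteinValues N α m k hf
  have hgw : ∀ w : GSlots, w.kn = [] → w.bf = [] → w.bg = [] → w.rr = [] → ({ w with kn := [], bf := [], bg := [], rr := [] } : GSlots) = w := by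
    rintro ⟨⟩ h1 h2 h3 h4; simp_all
  refine (h1.seq (h2.seq (h3.seq (h4.seq h5)))).of_eq ?_ (by rfl)
  rw [hvals, ← hgw u.gw hkn' hbf hbg hrr]
  simp [s4, s3, s2, s1, hble, hblc1, hx3]

end Bluestein

end Com

end Literature.Computability.Complexity
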